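import Literature.NumberTheory.Sieve.SmoothEndgame
import Literature.NumberTheory.Sieve.PsiPolylogLowerBound
import Literature.NumberTheory.Sieve.SmoothSaddlePointPolylog
import Literature.NumberTheory.Sieve.RankinSmoothNumbers
import Mathlib.Analysis.SpecialFunctions.Pow.Asymptotics
import HarnessLib

/-!
# Smooth solutions of `a + b = c`: Harper's Corollary 1 along good levels

Topic `Literature/NumberTheory/Sieve`; a PROVED file toward
`Literature.NumberTheory.DiophantineGeometry.XYZUpperHalf` ([Harper2016, Cor. 1]). Along the good
levels `y` of `SmoothCharacterDecayGoodLevel.exists_goodLevel` we take `x = ⌈exp(y^{1/(K+1)})⌉`, so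
that `(log x)^K ≤ y ≤ (log x)^{K+1}`, verify the regime and the two smallness conditions of
`Endgame.count_lower_bound`, and deduce that the number of pairs `(a, b)`, `a + b ≤ x`, with
`ab(a+b)` having all its prime factors `≤ (log x)^{K+2}`, is at least `x^{3/2}` for arbitrarily large
natural `x` (`smooth_abc_pairs_frequently`) — the input of
`Literature.NumberTheory.DiophantineGeometry.xyzUpperHalf_of_frequently_le_ncard`.

## References

* A. J. Harper, Compositio Math. 152 (2016), Cor. 1 and §5 [Harper2016].
* J. C. Lagarias, K. Soundararajan, J. Théor. Nombres Bordeaux 23 (2011), Thm. 1.4–1.5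
  [LagariasSoundararajan2011].
-/

noncomputable section

open Finset Real Complex Filter
open scoped FourierTransform Classical Topology

namespace Literature.NumberTheory.Sieve

namespace Endgame

open MontgomeryVaughan1975 TwistedWeight SmoothArcs Vinogradov

/-! ### Elementary growth lemmas -/

/-- `L^n ≤ e^L` once `L ≥ (n+1)!`. [folklore] -/
theorem pow_le_exp_of_factorial_le (n : ℕ) {L : ℝ} (hL : ((n + 1).factorial : ℝ) ≤ L) : L ^ n ≤ Real.exp L := by
  have hfac : (1 : ℝ) ≤ ((n + 1).factorial : ℝ) := by exact_mod_cast Nat.one_le_iff_ne_zero.mpr (Nat.factorial_ne_zero _)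
  have hL1 : 1 ≤ L := hfac.trans hL
  have hL0 : 0 < L := by linarith
  have h := Real.pow_div_factorial_le_exp (x := L) hL0.le (n + 1)
  rw [div_le_iff₀ (by positivity)] at h
  -- `L^{n+1} ≤ (n+1)! e^L ≤ L e^L`
  have h2 : L ^ n * L ≤ Real.exp L * L := by
    calc L ^ n * L = L ^ (n + 1) := by ring
      _ ≤ Real.exp L * ((n + 1).factorial : ℝ) := h
      _ ≤ Real.exp L * L := mul_le_mul_of_nonneg_left hL (Real.exp_pos L).le
  exact le_of_mul_le_mul_right h2 hL0

/-- `A L^n ≤ e^{aL}` once `L ≥ ((n+2)! + A/a^{n+1} … )`: an explicit threshold form. For `a > 0`,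
if `L ≥ (n+2)!/a` and `L ≥ A/a^{n+1}` then `A L^n ≤ exp(a L)`. [folklore] -/
theorem const_mul_pow_le_exp_mul (n : ℕ) {a A L : ℝ} (ha : 0 < a)
    (hL1 : ((n + 2).factorial : ℝ) / a ≤ L) (hL2 : A / a ^ (n + 1) ≤ L) : A * L ^ n ≤ Real.exp (a * L) := by
  have hfac : (1 : ℝ) ≤ ((n + 2).factorial : ℝ) := by exact_mod_cast Nat.one_le_iff_ne_zero.mpr (Nat.factorial_ne_zero _)
  have hM : ((n + 1 + 1).factorial : ℝ) ≤ a * L := by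
    rw [div_le_iff₀' ha] at hL1; exact hL1
  have hL0 : 0 < L := by
    have : 0 < ((n + 2).factorial : ℝ) / a := by positivity
    linarith
  have h := pow_le_exp_of_factorial_le (n + 1) hM
  -- `A L^n ≤ (aL)^{n+1} = a^{n+1} L^{n+1}` since `A ≤ a^{n+1} L`
  have hAle : A ≤ a ^ (n + 1) * L := by rw [div_le_iff₀' (by positivity)] at hL2; exact hL2
  calc A * L ^ n ≤ (a ^ (n + 1) * L) * L ^ n := mul_le_mul_of_nonneg_right hAle (by positivity)
    _ = (a * L) ^ (n + 1) := by ring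
    _ ≤ Real.exp (a * L) := h

/-- `log L ≤ L^ε/ε`, in the form `log L ≤ c L^ε` with `c = 1/ε`. [folklore] -/
theorem log_le_inv_mul_rpow {L ε : ℝ} (hL : 0 ≤ L) (hε : 0 < ε) : Real.log L ≤ ε⁻¹ * L ^ ε := by
  have := Real.log_le_rpow_div hL hε; rw [div_eq_inv_mul] at this; exact this

/-- Monotonicity of the truncated smooth numbers in the smoothness bound. [folklore] -/
theorem smoothNumbersUpTo_mono_right (N : ℕ) {k k' : ℕ} (h : k ≤ k') :
    Nat.smoothNumbersUpTo N k ⊆ Nat.smoothNumbersUpTo N k' := by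
  intro n hn
  rw [Nat.mem_smoothNumbersUpTo] at hn ⊢
  exact ⟨hn.1, Nat.smoothNumbers_mono h hn.2⟩

/-- `GoodLevel` is monotone in `δ`. [folklore] -/
theorem GoodLevel.mono {δ δ' θ : ℝ} {y : ℕ} (h : GoodLevel δ θ y) (hδ : δ ≤ δ') (hy : 1 ≤ y) :
    GoodLevel δ' θ y := by
  intro q χ hχ hq1 hqy x hh hx hhy
  refine (h q χ hχ hq1 hqy x hh hx hhy).trans ?_
  have hy0 : (0 : ℝ) < y := by exact_mod_cast hy
  have : 0 ≤ (hh : ℝ) + y / (y : ℝ) ^ θ := by positivity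
  exact mul_le_mul_of_nonneg_right hδ this

/-! ### The decay parameter `ν(Λ)` is small -/

/-- `C_Λ = 2 + 6(2πΛ) + 6(2πΛ)² + (2πΛ)³ ≤ 530 Λ³` for `Λ ≥ 1`. [folklore] -/
theorem decayConst_le_cube {Λ : ℝ} (hΛ : 1 ≤ Λ) :
    2 + 6 * (2 * π * |Λ|) + 6 * (2 * π * |Λ|) ^ 2 + (2 * π * |Λ|) ^ 3 ≤ 530 * Λ ^ 3 := by
  rw [abs_of_nonneg (by linarith)]
  have hπ : π < 3.15 := Real.pi_lt_d2
  have hπ0 : 0 < π := Real.pi_pos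
  have hΛ0 : 0 ≤ Λ := by linarith
  have h1 : Λ ≤ Λ ^ 3 := le_self_pow₀ hΛ (by norm_num)
  have h2 : Λ ^ 2 ≤ Λ ^ 3 := pow_le_pow_right₀ hΛ (by norm_num)
  have h3 : (1 : ℝ) ≤ Λ ^ 3 := one_le_pow₀ hΛ
  have hπ1 : π ≤ 3.15 := hπ.le
  have k1 : π * Λ ≤ 3.15 * Λ ^ 3 := by
    calc π * Λ ≤ 3.15 * Λ := mul_le_mul_of_nonneg_right hπ1 hΛ0
      _ ≤ 3.15 * Λ ^ 3 := by linarith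
  have k2 : π ^ 2 * Λ ^ 2 ≤ 3.15 ^ 2 * Λ ^ 3 := by
    have : π ^ 2 ≤ 3.15 ^ 2 := pow_le_pow_left₀ hπ0.le hπ1 2
    calc π ^ 2 * Λ ^ 2 ≤ 3.15 ^ 2 * Λ ^ 2 := mul_le_mul_of_nonneg_right this (by positivity)
      _ ≤ 3.15 ^ 2 * Λ ^ 3 := mul_le_mul_of_nonneg_left h2 (by norm_num)
  have k3 : π ^ 3 * Λ ^ 3 ≤ 3.15 ^ 3 * Λ ^ 3 := by
    have : π ^ 3 ≤ 3.15 ^ 3 := pow_le_pow_left₀ hπ0.le hπ1 3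
    exact mul_le_mul_of_nonneg_right this (by positivity)
  have e : 2 + 6 * (2 * π * Λ) + 6 * (2 * π * Λ) ^ 2 + (2 * π * Λ) ^ 3 =
      2 + 12 * (π * Λ) + 24 * (π ^ 2 * Λ ^ 2) + 8 * (π ^ 3 * Λ ^ 3) := by ring
  rw [e]
  norm_num at k1 k2 k3 ⊢
  linarith

set_option maxHeartbeats 1600000 in
/-- **`ν(Λ)` is small.** For `0 < θ ≤ 1/5`, `820 ≤ Kθ`, `c > 0` there is `L₀` such that for
`L = log x ≥ L₀`, `L^K ≤ y ≤ L^{K+1}`, `0 ≤ α ≤ 1` and `y^{1−α} ≥ c·u log(u+1)` (`u = L/log y`):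
`ν(L^{100}) ≤ L^{−502}`. [cite: Harper2016, §5, Appendix] -/
theorem decayNu_le {K : ℕ} {θ c : ℝ} (hθ0 : 0 < θ) (hθ : θ ≤ 1 / 5) (hK : 820 ≤ (K : ℝ) * θ) (hc : 0 < c) :
    ∃ L₀ : ℝ, ∀ (x : ℝ) (y : ℕ) (α : ℝ), L₀ ≤ Real.log x → Real.log x ^ K ≤ y → (y : ℝ) ≤ Real.log x ^ (K + 1) →
      0 ≤ α → α ≤ 1 →
      c * (Real.log x / Real.log y * Real.log (Real.log x / Real.log y + 1)) ≤ (y : ℝ) ^ (1 - α) →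
      decayNu y θ α (Real.log x ^ 100) ≤ (Real.log x ^ 502)⁻¹ := by
  -- thresholds
  set A : ℝ := 5120 * ((K : ℝ) + 1) ^ 2 * ((K : ℝ) + 503) / c with hA
  have hA0 : 0 < A := by rw [hA]; positivity
  refine ⟨max (max 3 (4 * ((K : ℝ) + 1) ^ 2)) (A ^ 4), fun x y α hL hyK hyK' hα0 hα1 hlow => ?_⟩
  set L : ℝ := Real.log x with hLdef
  have hL3 : 3 ≤ L := le_trans ((le_max_left _ _).trans (le_max_left _ _)) hL
  have hLK : 4 * ((K : ℝ) + 1) ^ 2 ≤ L := le_trans ((le_max_right _ _).trans (le_max_left _ _)) hL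
  have hLA : A ^ 4 ≤ L := le_trans (le_max_right _ _) hL
  have hL1 : 1 ≤ L := by linarith
  have hL0 : 0 < L := by linarith
  have hK1 : (1 : ℝ) ≤ K := by
    have : (K : ℝ) * θ ≤ K * (1 / 5) := mul_le_mul_of_nonneg_left hθ (Nat.cast_nonneg K); nlinarith
  have hKnat : 1 ≤ K := by exact_mod_cast hK1
  -- `y ≥ L^K ≥ L ≥ 3`
  set Y : ℝ := (y : ℝ) with hY
  have hLK' : L ≤ L ^ K := le_self_pow₀ hL1 (by omega)
  have hY3 : 3 ≤ Y := by linarith [hLK'.trans hyK]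
  have hY1 : 1 < Y := by linarith
  have hY0 : 0 < Y := by linarith
  have hlogY : 0 < Real.log Y := Real.log_pos hY1
  have hlogL : 0 < Real.log L := Real.log_pos (by linarith)
  -- `log Y ≤ (K+1) log L`, `log Y ≥ K log L ≥ log L ≥ 1`
  have hlogYle : Real.log Y ≤ ((K : ℝ) + 1) * Real.log L := by
    have := Real.log_le_log hY0 hyK'
    rw [Real.log_pow] at this; push_cast at this; exact this
  have hlogL1 : 1 ≤ Real.log L := by
    rw [Real.le_log_iff_exp_le hL0]; have := Real.exp_one_lt_d9; linarith
  have hlogYge : 1 ≤ Real.log Y := by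
    have := Real.log_le_log (by positivity) hyK
    rw [Real.log_pow] at this
    have hK0 : (1 : ℝ) ≤ K * Real.log L := by nlinarith
    linarith
  -- ### `Y^{θ/2} ≥ L^{410}`
  have hYθ : L ^ 410 ≤ Y ^ (θ / 2) := by
    have h1 : (L ^ K) ^ (θ / 2) ≤ Y ^ (θ / 2) := Real.rpow_le_rpow (by positivity) hyK (by linarith)
    have h2 : (L ^ K : ℝ) ^ (θ / 2) = L ^ ((K : ℝ) * (θ / 2)) := by
      rw [← Real.rpow_natCast L K, ← Real.rpow_mul hL0.le]
    have h3 : L ^ (410 : ℕ) ≤ L ^ ((K : ℝ) * (θ / 2)) := by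
      rw [← Real.rpow_natCast L 410]
      exact Real.rpow_le_rpow_of_exponent_le hL1 (by push_cast; nlinarith)
    linarith [h2 ▸ h1]
  have hL410 : (6 : ℝ) ≤ L ^ 410 := by
    calc (6 : ℝ) ≤ 3 ^ 2 := by norm_num
      _ ≤ L ^ 2 := pow_le_pow_left₀ (by norm_num) hL3 2
      _ ≤ L ^ 410 := pow_le_pow_right₀ hL1 (by norm_num)
  have hYθ6 : 6 ≤ Y ^ (θ / 2) := hL410.trans hYθ
  have hYθpos : 0 < Y ^ (θ / 2) := by linarith
  -- ### the tail term `2π C_Λ/T₀² ≤ ½ L^{-502}`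
  set Λ : ℝ := L ^ 100 with hΛ
  have hΛ1 : 1 ≤ Λ := one_le_pow₀ hL1
  have hT₀sq : L ^ 820 / 1600 ≤ (Y ^ (θ / 2) / 40) ^ 2 := by
    rw [div_pow]
    have : (L ^ 410) ^ 2 ≤ (Y ^ (θ / 2)) ^ 2 := pow_le_pow_left₀ (by positivity) hYθ 2
    have e : (L ^ 410) ^ 2 = L ^ 820 := by ring
    rw [e] at this
    have : L ^ 820 / 1600 = L ^ 820 / 40 ^ 2 := by norm_num
    rw [this]
    exact div_le_div_of_nonneg_right (by linarith) (by norm_num)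
  have hπ : π < 3.15 := Real.pi_lt_d2
  have hπ0 := Real.pi_pos
  have htail : 2 * π * (2 + 6 * (2 * π * |Λ|) + 6 * (2 * π * |Λ|) ^ 2 + (2 * π * |Λ|) ^ 3) /
      (Y ^ (θ / 2) / 40) ^ 2 ≤ 1 / 2 * (L ^ 502)⁻¹ := by
    have hC := decayConst_le_cube hΛ1
    have hnum : 2 * π * (2 + 6 * (2 * π * |Λ|) + 6 * (2 * π * |Λ|) ^ 2 + (2 * π * |Λ|) ^ 3) ≤ 3339 * L ^ 300 := by
      have e3 : Λ ^ 3 = L ^ 300 := by rw [hΛ]; ring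
      have hΛ3 : 0 ≤ Λ ^ 3 := by positivity
      calc _ ≤ 2 * π * (530 * Λ ^ 3) := mul_le_mul_of_nonneg_left hC (by positivity)
        _ ≤ 6.3 * (530 * Λ ^ 3) := mul_le_mul_of_nonneg_right (by linarith) (by positivity)
        _ = 3339 * L ^ 300 := by rw [e3]; ring
    have hden : 0 < (Y ^ (θ / 2) / 40) ^ 2 := by positivity
    calc _ ≤ 3339 * L ^ 300 / (L ^ 820 / 1600) := by
          apply div_le_div₀ (by positivity) hnum (by positivity) hT₀sq
      _ = 5342400 * (L ^ 520)⁻¹ := by field_simp; ring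
      _ ≤ 1 / 2 * (L ^ 502)⁻¹ := by
          rw [show L ^ 520 = L ^ 18 * L ^ 502 by ring, mul_inv]
          have h18 : (10684800 : ℝ) ≤ L ^ 18 := by
            calc (10684800 : ℝ) ≤ 3 ^ 18 := by norm_num
              _ ≤ L ^ 18 := pow_le_pow_left₀ (by norm_num) hL3 18
          have hi : (L ^ 18)⁻¹ ≤ 10684800⁻¹ := inv_anti₀ (by norm_num) h18
          have h502 : 0 < (L ^ 502)⁻¹ := by positivity
          nlinarith
  -- ### the main term `2 T₀ e^{-D₀/5} ≤ ½ L^{-502}`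
  -- the integral: `∫_{3Y^{1-θ/2}}^{Y} v^{-α} ≥ Y^{1-α}/2`
  set a : ℝ := 3 * Y ^ (1 - θ / 2) with ha
  have ha0 : 0 < a := by positivity
  have haY : a ≤ Y / 2 := by
    -- `3 Y^{1-θ/2} ≤ Y/2 ⟺ 6 ≤ Y^{θ/2}`
    have e : Y ^ (1 - θ / 2) * Y ^ (θ / 2) = Y := by
      rw [← Real.rpow_add hY0]; norm_num
    have h0 : 0 < Y ^ (1 - θ / 2) := by positivity
    have key : 6 * Y ^ (1 - θ / 2) ≤ Y ^ (1 - θ / 2) * Y ^ (θ / 2) := by nlinarith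
    rw [e] at key
    rw [ha]; linarith
  have hint : Y ^ (1 - α) / 2 ≤ ∫ v in a..Y, v ^ (-α) := by
    have haY' : a ≤ Y := by linarith
    have hmono : ∫ v in a..Y, Y ^ (-α) ≤ ∫ v in a..Y, v ^ (-α) := by
      refine intervalIntegral.integral_mono_on haY' intervalIntegrable_const ?_ ?_
      · exact intervalIntegral.intervalIntegrable_rpow (Or.inr (by rw [Set.uIcc_of_le haY']; intro h; exact absurd h.1 (by linarith)))
      · intro v hv
        exact Real.rpow_le_rpow_of_nonpos (by linarith [hv.1]) hv.2 (by linarith)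
    rw [intervalIntegral.integral_const, smul_eq_mul] at hmono
    have e : Y ^ (1 - α) = Y * Y ^ (-α) := by
      rw [show (1 - α) = 1 + (-α) by ring, Real.rpow_add hY0, Real.rpow_one]
    rw [e]
    have : 0 ≤ Y ^ (-α) := Real.rpow_nonneg hY0.le _
    nlinarith
  -- `D₀ ≥ Y^{1-α}/(8 log Y)`
  set D₀ : ℝ := 1 / (4 * Real.log Y) * ∫ v in a..Y, v ^ (-α) with hD₀
  have hD₀ge : Y ^ (1 - α) / (8 * Real.log Y) ≤ D₀ := by
    rw [hD₀]
    have : Y ^ (1 - α) / (8 * Real.log Y) = 1 / (4 * Real.log Y) * (Y ^ (1 - α) / 2) := by field_simp; ring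
    rw [this]
    exact mul_le_mul_of_nonneg_left hint (by positivity)
  -- `Y^{1-α} ≥ c L/(2 (K+1) log L)`
  set u : ℝ := L / Real.log Y with hu
  have hu1 : 1 ≤ u := by
    rw [hu, le_div_iff₀ hlogY, one_mul]
    refine hlogYle.trans ?_
    -- `(K+1) log L ≤ (K+1) · 2 √L ≤ L` from `L ≥ 4(K+1)²`
    have hlog : Real.log L ≤ 2 * L ^ (1 / 2 : ℝ) := by
      have := log_le_inv_mul_rpow hL0.le (show (0 : ℝ) < 1 / 2 by norm_num); norm_num at this; linarith
    have hsq : L ^ (1 / 2 : ℝ) * L ^ (1 / 2 : ℝ) = L := by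
      rw [← Real.rpow_add hL0]; norm_num
    have hs0 : 0 ≤ L ^ (1 / 2 : ℝ) := Real.rpow_nonneg hL0.le _
    have hK2 : 2 * ((K : ℝ) + 1) ≤ L ^ (1 / 2 : ℝ) := by
      nlinarith [hsq, hLK]
    calc ((K : ℝ) + 1) * Real.log L ≤ ((K : ℝ) + 1) * (2 * L ^ (1 / 2 : ℝ)) := mul_le_mul_of_nonneg_left hlog (by positivity)
      _ = (2 * ((K : ℝ) + 1)) * L ^ (1 / 2 : ℝ) := by ring
      _ ≤ L ^ (1 / 2 : ℝ) * L ^ (1 / 2 : ℝ) := mul_le_mul_of_nonneg_right hK2 hs0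
      _ = L := hsq
  have hlogu : 1 / 2 ≤ Real.log (u + 1) := by
    have h2 : Real.log 2 ≤ Real.log (u + 1) := Real.log_le_log (by norm_num) (by linarith)
    have := Real.log_two_gt_d9; linarith
  have hYlow : c * L / (2 * (((K : ℝ) + 1) * Real.log L)) ≤ Y ^ (1 - α) := by
    refine le_trans ?_ hlow
    have hule : L / (((K : ℝ) + 1) * Real.log L) ≤ u := by
      rw [hu]; exact div_le_div_of_nonneg_left hL0.le hlogY hlogYle
    have hu0 : 0 ≤ u := by linarith
    calc c * L / (2 * (((K : ℝ) + 1) * Real.log L)) = c * (L / (((K : ℝ) + 1) * Real.log L) * (1 / 2)) := by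
          field_simp
      _ ≤ c * (u * Real.log (u + 1)) := by
          apply mul_le_mul_of_nonneg_left _ hc.le
          exact mul_le_mul hule hlogu (by norm_num) hu0
  -- `D₀ ≥ cL/(16 (K+1)² log² L) ≥ 5 (K+503) log L`
  have hD₀low : 5 * (((K : ℝ) + 503) * Real.log L) ≤ D₀ := by
    refine le_trans ?_ hD₀ge
    have h1 : c * L / (2 * (((K : ℝ) + 1) * Real.log L)) / (8 * Real.log Y) ≤ Y ^ (1 - α) / (8 * Real.log Y) :=
      div_le_div_of_nonneg_right hYlow (by positivity)
    refine le_trans ?_ h1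
    rw [div_div, le_div_iff₀ (by positivity)]
    -- `5 (K+503) log L · 2(K+1) log L · 8 log Y ≤ c L`, using `log Y ≤ (K+1) log L`, `log³ L ≤ 64 L^{3/4}`, `A L^{3/4} ≤ L`
    have hlog4 : Real.log L ≤ 4 * L ^ (1 / 4 : ℝ) := by
      have := log_le_inv_mul_rpow hL0.le (show (0 : ℝ) < 1 / 4 by norm_num); norm_num at this; linarith
    have hl0 : 0 ≤ Real.log L := hlogL.le
    have hlog3 : Real.log L ^ 3 ≤ 64 * L ^ (3 / 4 : ℝ) := by
      have : (4 * L ^ (1 / 4 : ℝ)) ^ 3 = 64 * L ^ (3 / 4 : ℝ) := by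
        rw [mul_pow, ← Real.rpow_natCast (L ^ (1 / 4 : ℝ)) 3, ← Real.rpow_mul hL0.le]; norm_num
      rw [← this]; exact pow_le_pow_left₀ hl0 hlog4 3
    -- `A^4 ≤ L` gives `A L^{3/4} ≤ L`
    have hL34 : A * L ^ (3 / 4 : ℝ) ≤ L := by
      have hA4 : A ≤ L ^ (1 / 4 : ℝ) := by
        have := Real.rpow_le_rpow (by positivity) hLA (show (0 : ℝ) ≤ 1 / 4 by norm_num)
        rw [← Real.rpow_natCast A 4, ← Real.rpow_mul hA0.le] at this; norm_num at this; exact this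
      have e : L = L ^ (1 / 4 : ℝ) * L ^ (3 / 4 : ℝ) := by rw [← Real.rpow_add hL0]; norm_num
      conv_rhs => rw [e]
      exact mul_le_mul_of_nonneg_right hA4 (Real.rpow_nonneg hL0.le _)
    have hAdef : A * c = 5120 * ((K : ℝ) + 1) ^ 2 * ((K : ℝ) + 503) := by rw [hA]; field_simp
    calc 5 * (((K : ℝ) + 503) * Real.log L) * (2 * (((K : ℝ) + 1) * Real.log L) * (8 * Real.log Y))
        ≤ 5 * (((K : ℝ) + 503) * Real.log L) * (2 * (((K : ℝ) + 1) * Real.log L) * (8 * (((K : ℝ) + 1) * Real.log L))) := by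
          gcongr
      _ = 80 * ((K : ℝ) + 1) ^ 2 * ((K : ℝ) + 503) * Real.log L ^ 3 := by ring
      _ ≤ 80 * ((K : ℝ) + 1) ^ 2 * ((K : ℝ) + 503) * (64 * L ^ (3 / 4 : ℝ)) := mul_le_mul_of_nonneg_left hlog3 (by positivity)
      _ = (A * c) * L ^ (3 / 4 : ℝ) := by rw [hAdef]; ring
      _ = c * (A * L ^ (3 / 4 : ℝ)) := by ring
      _ ≤ c * L := mul_le_mul_of_nonneg_left hL34 hc.le
  -- `2 T₀ e^{-D₀/5} ≤ 2 (L^{K+1}/40) L^{-(K+503)} ≤ ½ L^{-502}`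
  have hexpD : Real.exp (-(D₀ / 5)) ≤ (L ^ (K + 503))⁻¹ := by
    have h1 : Real.exp (-(D₀ / 5)) ≤ Real.exp (-(((K : ℝ) + 503) * Real.log L)) := Real.exp_le_exp.mpr (by linarith)
    refine h1.trans (le_of_eq ?_)
    rw [Real.exp_neg, show ((K : ℝ) + 503) = ((K + 503 : ℕ) : ℝ) by push_cast; ring, Real.exp_nat_mul, Real.exp_log hL0]
  have hT₀le : Y ^ (θ / 2) / 40 ≤ L ^ (K + 1) / 40 := by
    apply div_le_div_of_nonneg_right _ (by norm_num)
    calc Y ^ (θ / 2) ≤ Y ^ (1 : ℝ) := Real.rpow_le_rpow_of_exponent_le hY1.le (by linarith)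
      _ = Y := Real.rpow_one Y
      _ ≤ L ^ (K + 1) := hyK'
  have hmain : 2 * (Y ^ (θ / 2) / 40) * Real.exp (-(D₀ / 5)) ≤ 1 / 2 * (L ^ 502)⁻¹ := by
    calc 2 * (Y ^ (θ / 2) / 40) * Real.exp (-(D₀ / 5)) ≤ 2 * (L ^ (K + 1) / 40) * (L ^ (K + 503))⁻¹ :=
          mul_le_mul (mul_le_mul_of_nonneg_left hT₀le (by norm_num)) hexpD (Real.exp_pos _).le (by positivity)
      _ = 1 / 20 * (L ^ 502)⁻¹ := by
          rw [show L ^ (K + 503) = L ^ (K + 1) * L ^ 502 by ring]; field_simp; ring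
      _ ≤ 1 / 2 * (L ^ 502)⁻¹ := by
          have : 0 < (L ^ 502)⁻¹ := by positivity
          nlinarith
  -- ### assemble
  rw [decayNu]
  have e : (1 / (4 * Real.log ↑y) * ∫ (v : ℝ) in (3 * (y : ℝ) ^ (1 - θ / 2))..(y : ℝ), v ^ (-α)) = D₀ := by rw [hD₀]
  rw [e]
  linarith [hmain, htail]


/-! ### Bounds for `√(2π φ₂)` and the main quantity `𝓜` -/

/-- `√(2π φ₂(α,y)) ≤ 3√(3(K+1)) L` when `φ₂ ≤ 3 L log y`, `log y ≤ (K+1) log L`, `log L ≤ L`. [folklore] -/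
theorem sqrt_two_pi_phi_le {K : ℕ} {L φ ly : ℝ} (hL : 1 ≤ L) (hφ0 : 0 ≤ φ) (hφ : φ ≤ 3 * L * ly)
    (hly : ly ≤ ((K : ℝ) + 1) * Real.log L) :
    Real.sqrt (2 * π * φ) ≤ 3 * Real.sqrt (3 * ((K : ℝ) + 1)) * L := by
  have hπ : π < 3.15 := Real.pi_lt_d2
  have hπ0 := Real.pi_pos
  have hL0 : 0 < L := by linarith
  have hlogL : Real.log L ≤ L := (Real.log_le_sub_one_of_pos hL0).trans (by linarith)
  have hlogL0 : 0 ≤ Real.log L := Real.log_nonneg hL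
  have h1 : 2 * π * φ ≤ (3 * Real.sqrt (3 * ((K : ℝ) + 1)) * L) ^ 2 := by
    have hs : Real.sqrt (3 * ((K : ℝ) + 1)) ^ 2 = 3 * ((K : ℝ) + 1) := Real.sq_sqrt (by positivity)
    have hly' : ly ≤ ((K : ℝ) + 1) * L := hly.trans (mul_le_mul_of_nonneg_left hlogL (by positivity))
    calc 2 * π * φ ≤ 2 * π * (3 * L * ly) := mul_le_mul_of_nonneg_left hφ (by positivity)
      _ ≤ 6.3 * (3 * L * (((K : ℝ) + 1) * L)) := by
          have h0 : 0 ≤ 3 * L * ly := by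
            have : 0 ≤ 2 * π * φ := by positivity
            nlinarith
          have : 3 * L * ly ≤ 3 * L * (((K : ℝ) + 1) * L) := mul_le_mul_of_nonneg_left hly' (by positivity)
          nlinarith
      _ ≤ (3 * Real.sqrt (3 * ((K : ℝ) + 1)) * L) ^ 2 := by rw [mul_pow, mul_pow, hs]; nlinarith
  calc Real.sqrt (2 * π * φ) ≤ Real.sqrt ((3 * Real.sqrt (3 * ((K : ℝ) + 1)) * L) ^ 2) := Real.sqrt_le_sqrt h1
    _ = 3 * Real.sqrt (3 * ((K : ℝ) + 1)) * L := Real.sqrt_sq (by positivity)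

/-- `x^α ζ(α,y) = 𝓜 √(2πφ₂)`. [folklore] -/
theorem rpow_mul_zeta_eq {x α φ ζ : ℝ} (hφ : 0 < φ) :
    x ^ α * ζ = (x ^ α * ζ / Real.sqrt (2 * Real.pi * φ)) * Real.sqrt (2 * π * φ) := by
  have : 0 < Real.sqrt (2 * π * φ) := Real.sqrt_pos.mpr (by positivity)
  field_simp

set_option maxHeartbeats 1600000 in
/-- **The junk of the arcs is small.** For `L = log x ≥ L₀`, `2 ≤ y`, `log y ≤ (K+1) log L`,
`0 < α ≤ 1`, `φ₂(α,y) ≤ 3 L log y` and `ν(L^{100}) ≤ L^{−502}`, the smallness hypothesis of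
`count_lower_bound` holds with `Λ = L^{100}`. [cite: Harper2016, §5] -/
theorem junk_small (K : ℕ) (θ : ℝ) :
    ∃ L₀ : ℝ, ∀ (x : ℝ) (y : ℕ) (α : ℝ), L₀ ≤ Real.log x → 0 < x → 2 ≤ y →
      Real.log y ≤ ((K : ℝ) + 1) * Real.log (Real.log x) → 0 < α → α ≤ 1 →
      saddlePhi₂ α y ≤ 3 * Real.log x * Real.log y →
      decayNu y θ α (Real.log x ^ 100) ≤ (Real.log x ^ 502)⁻¹ →
      (1 + Real.log x ^ 100) * ((Real.log x ^ 100) ^ 4 * ((x ^ α * smoothZeta α y / (2 * π)) *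
          decayNu y θ α (Real.log x ^ 100)) +
        2 * (x ^ α * smoothZeta α y / Real.sqrt (2 * Real.pi * saddlePhi₂ α y)) * (5 + 2 * π * Real.log x ^ 100) / x) ≤
        Real.exp (-66) * ((2 : ℝ) ^ (-α) * (x ^ α * smoothZeta α y / Real.sqrt (2 * Real.pi * saddlePhi₂ α y))) := by
  refine ⟨max (max 1 (24 * Real.sqrt (3 * ((K : ℝ) + 1)) * Real.exp 66))
      (max ((202 : ℕ).factorial / 1) (192 * Real.exp 66 / 1 ^ (200 + 1))),
    fun x y α hL hx hy2 hly hα0 hα1 hφ hν => ?_⟩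
  set L : ℝ := Real.log x with hLdef
  have hL1 : 1 ≤ L := le_trans ((le_max_left _ _).trans (le_max_left _ _)) hL
  have hLe : 24 * Real.sqrt (3 * ((K : ℝ) + 1)) * Real.exp 66 ≤ L := le_trans ((le_max_right _ _).trans (le_max_left _ _)) hL
  have hLf : ((202 : ℕ).factorial : ℝ) / 1 ≤ L := le_trans ((le_max_left _ _).trans (le_max_right _ _)) hL
  have hLg : 192 * Real.exp 66 / 1 ^ (200 + 1) ≤ L := le_trans ((le_max_right _ _).trans (le_max_right _ _)) hL
  have hL0 : 0 < L := by linarith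
  have hπ := Real.pi_pos
  have hπ3 : π < 3.15 := Real.pi_lt_d2
  have hφ0 : 0 < saddlePhi₂ α y := saddlePhi₂_pos hy2 hα0
  have hζ : 0 < smoothZeta α y := smoothZeta_pos hα0
  set Mx : ℝ := x ^ α * smoothZeta α y / Real.sqrt (2 * Real.pi * saddlePhi₂ α y) with hMx
  have hMx0 : 0 < Mx := by rw [hMx]; exact div_pos (by positivity) (Real.sqrt_pos.mpr (by positivity))
  set Λ : ℝ := L ^ 100 with hΛ
  have hΛ1 : 1 ≤ Λ := one_le_pow₀ hL1
  have hΛ0 : 0 ≤ Λ := by linarith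
  -- `√(2πφ₂)/(2π) ≤ √φ₂ ≤ √(3(K+1)) L`
  have hsq := sqrt_two_pi_phi_le (K := K) hL1 hφ0.le hφ hly
  have hxζ : x ^ α * smoothZeta α y = Mx * Real.sqrt (2 * π * saddlePhi₂ α y) := rpow_mul_zeta_eq hφ0
  -- ### the non-principal junk
  have h1 : (1 + Λ) * (Λ ^ 4 * ((x ^ α * smoothZeta α y / (2 * π)) * decayNu y θ α Λ)) ≤ Real.exp (-66) * Mx / 4 := by
    have hν0 := decayNu_nonneg y θ α Λ
    rw [hxζ]
    have hstep : (1 + Λ) * (Λ ^ 4 * ((Mx * Real.sqrt (2 * π * saddlePhi₂ α y) / (2 * π)) * decayNu y θ α Λ)) ≤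
        (2 * Λ ^ 5) * (Mx * (3 * Real.sqrt (3 * ((K : ℝ) + 1)) * L) * (L ^ 502)⁻¹) := by
      have ha : (1 + Λ) * Λ ^ 4 ≤ 2 * Λ ^ 5 := by nlinarith [pow_nonneg hΛ0 4]
      have hb : Mx * Real.sqrt (2 * π * saddlePhi₂ α y) / (2 * π) ≤ Mx * (3 * Real.sqrt (3 * ((K : ℝ) + 1)) * L) := by
        rw [div_le_iff₀ (by positivity)]
        have h2π : (1 : ℝ) ≤ 2 * π := by linarith [Real.pi_gt_three]
        calc Mx * Real.sqrt (2 * π * saddlePhi₂ α y) ≤ Mx * (3 * Real.sqrt (3 * ((K : ℝ) + 1)) * L) :=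
              mul_le_mul_of_nonneg_left hsq hMx0.le
          _ ≤ Mx * (3 * Real.sqrt (3 * ((K : ℝ) + 1)) * L) * (2 * π) := le_mul_of_one_le_right (by positivity) h2π
      calc (1 + Λ) * (Λ ^ 4 * ((Mx * Real.sqrt (2 * π * saddlePhi₂ α y) / (2 * π)) * decayNu y θ α Λ))
          = ((1 + Λ) * Λ ^ 4) * ((Mx * Real.sqrt (2 * π * saddlePhi₂ α y) / (2 * π)) * decayNu y θ α Λ) := by ring
        _ ≤ (2 * Λ ^ 5) * ((Mx * (3 * Real.sqrt (3 * ((K : ℝ) + 1)) * L)) * (L ^ 502)⁻¹) := by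
            apply mul_le_mul ha (mul_le_mul hb hν hν0 (by positivity)) (by positivity) (by positivity)
        _ = _ := by ring
    refine hstep.trans ?_
    -- `2 L^{500} · Mx · 3√(3(K+1)) L / L^{502} = 6√(3(K+1)) Mx/L ≤ e^{-66} Mx/4`
    have e : (2 * Λ ^ 5) * (Mx * (3 * Real.sqrt (3 * ((K : ℝ) + 1)) * L) * (L ^ 502)⁻¹) =
        6 * Real.sqrt (3 * ((K : ℝ) + 1)) * Mx / L := by
      rw [hΛ]; field_simp; ring
    rw [e, div_le_iff₀ hL0]
    -- need `24 √(3(K+1)) ≤ e^{-66} L`, i.e. `24 √(3(K+1)) e^{66} ≤ L`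
    have hee : Real.exp (-66) * Real.exp 66 = 1 := by rw [← Real.exp_add]; norm_num
    have hs0 : 0 ≤ Real.sqrt (3 * ((K : ℝ) + 1)) := Real.sqrt_nonneg _
    have key : 24 * Real.sqrt (3 * ((K : ℝ) + 1)) ≤ Real.exp (-66) * L := by
      have := mul_le_mul_of_nonneg_left hLe (Real.exp_pos (-66)).le
      calc 24 * Real.sqrt (3 * ((K : ℝ) + 1)) = (Real.exp (-66) * Real.exp 66) * (24 * Real.sqrt (3 * ((K : ℝ) + 1))) := by
            rw [hee, one_mul]
        _ = Real.exp (-66) * (24 * Real.sqrt (3 * ((K : ℝ) + 1)) * Real.exp 66) := by ring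
        _ ≤ Real.exp (-66) * L := this
    nlinarith [hMx0]
  -- ### the model junk
  have h2 : (1 + Λ) * (2 * Mx * (5 + 2 * π * Λ) / x) ≤ Real.exp (-66) * Mx / 4 := by
    have hx' : Real.exp L = x := by rw [hLdef]; exact Real.exp_log hx
    have hbig : 192 * Real.exp 66 * L ^ 200 ≤ x := by
      have := const_mul_pow_le_exp_mul 200 (a := 1) (A := 192 * Real.exp 66) one_pos hLf hLg
      rwa [one_mul, hx'] at this
    have hnum : (1 + Λ) * (2 * Mx * (5 + 2 * π * Λ)) ≤ 48 * L ^ 200 * Mx := by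
      have ha : 1 + Λ ≤ 2 * Λ := by linarith
      have hb : 5 + 2 * π * Λ ≤ 12 * Λ := by nlinarith
      calc (1 + Λ) * (2 * Mx * (5 + 2 * π * Λ)) ≤ (2 * Λ) * (2 * Mx * (12 * Λ)) :=
            mul_le_mul ha (mul_le_mul_of_nonneg_left hb (by positivity)) (by positivity) (by positivity)
        _ = 48 * L ^ 200 * Mx := by rw [hΛ]; ring
    rw [← mul_div_assoc, div_le_iff₀ hx]
    refine hnum.trans ?_
    have hee : Real.exp (-66) * Real.exp 66 = 1 := by rw [← Real.exp_add]; norm_num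
    have := mul_le_mul_of_nonneg_left hbig (by positivity : 0 ≤ Real.exp (-66) * Mx / 4)
    calc 48 * L ^ 200 * Mx = (Real.exp (-66) * Real.exp 66) * (48 * L ^ 200 * Mx) := by rw [hee, one_mul]
      _ = Real.exp (-66) * Mx / 4 * (192 * Real.exp 66 * L ^ 200) := by ring
      _ ≤ Real.exp (-66) * Mx / 4 * x := this
  -- ### combine, using `2^{-α} ≥ 1/2`
  have h2α : 1 / 2 ≤ (2 : ℝ) ^ (-α) := by
    rw [Real.rpow_neg (by norm_num), one_div]
    apply inv_anti₀ (by positivity)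
    calc (2 : ℝ) ^ α ≤ 2 ^ (1 : ℝ) := Real.rpow_le_rpow_of_exponent_le (by norm_num) hα1
      _ = 2 := Real.rpow_one 2
  have hε := Real.exp_pos (-66)
  calc _ = (1 + Λ) * (Λ ^ 4 * ((x ^ α * smoothZeta α y / (2 * π)) * decayNu y θ α Λ)) +
        (1 + Λ) * (2 * Mx * (5 + 2 * π * Λ) / x) := by ring
    _ ≤ Real.exp (-66) * Mx / 4 + Real.exp (-66) * Mx / 4 := add_le_add h1 h2
    _ = Real.exp (-66) * ((1 / 2) * Mx) := by ring
    _ ≤ Real.exp (-66) * ((2 : ℝ) ^ (-α) * Mx) := by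
        apply mul_le_mul_of_nonneg_left _ hε.le
        exact mul_le_mul_of_nonneg_right h2α hMx0.le

set_option maxHeartbeats 800000 in
/-- **`𝓜 ≥ x^{0.99}`.** From `Ψ(x,y) ≥ x^{39999/40000}` (for the count over `n ≤ N ≤ x`), Rankin's
bound `Ψ ≤ N^α ζ(α,y)` and `√(2πφ₂) ≤ 3√(3(K+1)) log x`. [cite: Harper2016, §5] -/
theorem main_quantity_ge (K : ℕ) :
    ∃ L₀ : ℝ, ∀ (x : ℝ) (N y : ℕ) (α : ℝ), L₀ ≤ Real.log x → 0 < x → (N : ℝ) ≤ x → 2 ≤ y →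
      Real.log y ≤ ((K : ℝ) + 1) * Real.log (Real.log x) → 0 < α →
      saddlePhi₂ α y ≤ 3 * Real.log x * Real.log y →
      x ^ ((39999 : ℝ) / 40000) ≤ ((Nat.smoothNumbersUpTo N (y + 1)).card : ℝ) →
      x ^ ((99 : ℝ) / 100) ≤ x ^ α * smoothZeta α y / Real.sqrt (2 * Real.pi * saddlePhi₂ α y) := by
  refine ⟨max 1 (max ((1 + 2 : ℕ).factorial / (399 / 40000 : ℝ)) (3 * Real.sqrt (3 * ((K : ℝ) + 1)) / (399 / 40000 : ℝ) ^ (1 + 1))),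
    fun x N y α hL hx hNx hy2 hly hα0 hφ hΨ => ?_⟩
  set L : ℝ := Real.log x with hLdef
  have hL1 : 1 ≤ L := le_trans (le_max_left _ _) hL
  have hLa : ((1 + 2 : ℕ).factorial : ℝ) / (399 / 40000 : ℝ) ≤ L := le_trans ((le_max_left _ _).trans (le_max_right _ _)) hL
  have hLb : 3 * Real.sqrt (3 * ((K : ℝ) + 1)) / (399 / 40000 : ℝ) ^ (1 + 1) ≤ L := le_trans ((le_max_right _ _).trans (le_max_right _ _)) hL
  have hL0 : 0 < L := by linarith
  have hφ0 : 0 < saddlePhi₂ α y := saddlePhi₂_pos hy2 hα0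
  have hζ : 0 < smoothZeta α y := smoothZeta_pos hα0
  set Mx : ℝ := x ^ α * smoothZeta α y / Real.sqrt (2 * Real.pi * saddlePhi₂ α y) with hMx
  have hMx0 : 0 < Mx := by rw [hMx]; exact div_pos (by positivity) (Real.sqrt_pos.mpr (by positivity))
  -- Rankin: `Ψ ≤ N^α ζ ≤ x^α ζ = Mx √(2πφ₂) ≤ Mx · 3√(3(K+1)) L`
  have hR := card_smoothNumbersUpTo_le_rankin N (y + 1) hα0
  rw [← smoothZeta_eq_prod_primesBelow] at hR
  have hNα : (N : ℝ) ^ α ≤ x ^ α := Real.rpow_le_rpow (Nat.cast_nonneg N) hNx hα0.le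
  have hsq := sqrt_two_pi_phi_le (K := K) hL1 hφ0.le hφ hly
  have hxζ : x ^ α * smoothZeta α y = Mx * Real.sqrt (2 * π * saddlePhi₂ α y) := rpow_mul_zeta_eq hφ0
  have hchain : x ^ ((39999 : ℝ) / 40000) ≤ Mx * (3 * Real.sqrt (3 * ((K : ℝ) + 1)) * L) := by
    calc x ^ ((39999 : ℝ) / 40000) ≤ ((Nat.smoothNumbersUpTo N (y + 1)).card : ℝ) := hΨ
      _ ≤ (N : ℝ) ^ α * smoothZeta α y := hR
      _ ≤ x ^ α * smoothZeta α y := mul_le_mul_of_nonneg_right hNα hζ.le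
      _ = Mx * Real.sqrt (2 * π * saddlePhi₂ α y) := hxζ
      _ ≤ Mx * (3 * Real.sqrt (3 * ((K : ℝ) + 1)) * L) := mul_le_mul_of_nonneg_left hsq hMx0.le
  -- `3√(3(K+1)) L ≤ exp(0.009975 L) = x^{0.009975}`
  have hsmall : 3 * Real.sqrt (3 * ((K : ℝ) + 1)) * L ≤ x ^ ((399 : ℝ) / 40000) := by
    have h := const_mul_pow_le_exp_mul 1 (a := 399 / 40000) (A := 3 * Real.sqrt (3 * ((K : ℝ) + 1))) (by norm_num) hLa hLb
    rw [pow_one] at h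
    refine h.trans (le_of_eq ?_)
    rw [hLdef, Real.rpow_def_of_pos hx]; ring_nf
  have hsplit : x ^ ((39999 : ℝ) / 40000) = x ^ ((99 : ℝ) / 100) * x ^ ((399 : ℝ) / 40000) := by
    rw [← Real.rpow_add hx]; norm_num
  have hx99 : 0 < x ^ ((99 : ℝ) / 100) := Real.rpow_pos_of_pos hx _
  have hx399 : 0 < x ^ ((399 : ℝ) / 40000) := Real.rpow_pos_of_pos hx _
  -- `x^{0.99} x^{0.009975} ≤ Mx · 3√(3(K+1))L ≤ Mx x^{0.009975}`
  have : x ^ ((99 : ℝ) / 100) * x ^ ((399 : ℝ) / 40000) ≤ Mx * x ^ ((399 : ℝ) / 40000) := by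
    rw [← hsplit]
    exact hchain.trans (mul_le_mul_of_nonneg_left hsmall hMx0.le)
  exact le_of_mul_le_mul_right this hx399


/-! ### The minor arcs are small -/

/-- `√(2π) ≤ 3` and `3^{5/2} ≤ 16`. [folklore] -/
theorem sqrt_two_pi_le_three : Real.sqrt (2 * π) ≤ 3 := by
  have hπ : π < 3.15 := Real.pi_lt_d2
  calc Real.sqrt (2 * π) ≤ Real.sqrt (3 ^ 2) := Real.sqrt_le_sqrt (by nlinarith)
    _ = 3 := Real.sqrt_sq (by norm_num)

/-- `3^{5/2} ≤ 16`. [folklore] -/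
theorem three_rpow_five_halves_le : (3 : ℝ) ^ ((5 : ℝ) / 2) ≤ 16 := by
  have h : (3 : ℝ) ^ ((5 : ℝ) / 2) = 3 ^ (2 : ℝ) * Real.sqrt 3 := by
    rw [Real.sqrt_eq_rpow, ← Real.rpow_add (by norm_num)]; norm_num
  have h3 : Real.sqrt 3 ≤ 7 / 4 := by
    calc Real.sqrt 3 ≤ Real.sqrt ((7 / 4) ^ 2) := Real.sqrt_le_sqrt (by norm_num)
      _ = 7 / 4 := Real.sqrt_sq (by norm_num)
  rw [h, show ((2 : ℝ)) = ((2 : ℕ) : ℝ) by norm_num, Real.rpow_natCast]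
  nlinarith [Real.sqrt_nonneg 3]

set_option maxHeartbeats 3200000 in
/-- **The minor arcs are small.** For `L = log x ≥ L₀(K, C, C', C_s)`, in the polylogarithmic regime
(`1 ≤ log y ≤ (K+1) log L`, `y ≤ L^{K+1}`), with `1 − 5·10⁻⁷ ≤ α ≤ 1`, `φ₂ ≤ 3L log y`,
`y^{1−α} ≤ C_s u log(u+1)`, `Ψ ≤ x^αζ(α,y)` and `𝓜 ≥ x^{0.99}`: the minor-arc smallness hypothesis of
`count_lower_bound` holds with `Λ = L^{100}`. [cite: Harper2016, Theorems 1–2, §5] -/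
theorem minor_small (K : ℕ) {C C' Cs : ℝ} (hC : 0 < C) (hC' : 0 < C') (hCs : 0 < Cs) :
    ∃ L₀ : ℝ, ∀ (x : ℝ) (y : ℕ) (α Ψ : ℝ), L₀ ≤ Real.log x → 0 < x → 2 ≤ y →
      1 ≤ Real.log y → Real.log y ≤ ((K : ℝ) + 1) * Real.log (Real.log x) → (y : ℝ) ≤ Real.log x ^ (K + 1) →
      0 < α → α ≤ 1 → 1 - 1 / 2000000 ≤ α →
      saddlePhi₂ α y ≤ 3 * Real.log x * Real.log y →
      (y : ℝ) ^ (1 - α) ≤ Cs * (Real.log x / Real.log y * Real.log (Real.log x / Real.log y + 1)) →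
      0 ≤ Ψ → Ψ ≤ x ^ α * smoothZeta α y →
      x ^ ((99 : ℝ) / 100) ≤ x ^ α * smoothZeta α y / Real.sqrt (2 * Real.pi * saddlePhi₂ α y) →
      C * Real.log x ^ (19 : ℕ) * (x ^ α * (smoothZeta α y / Real.sqrt (saddlePhi₂ α y))) ^ ((5 : ℝ) / 2) *
          Real.sqrt (C' * Real.log x ^ 3 * (y : ℝ) ^ (5 / 2 * (1 - α)) *
              (Real.log x ^ 100 / 2) ^ (-(1 / 2 : ℝ) + 3 / 2 * (1 - α)) *
              (x ^ α * (smoothZeta α y / Real.sqrt (saddlePhi₂ α y))) +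
            164 * (1 + Real.log x) ^ 2 * (y : ℝ) ^ 2 * x ^ (9 / 10 : ℝ) +
            32 * Ψ / (Real.log x ^ 100 / 2) ^ 2 + 1) ≤
        (((2 : ℝ) ^ (-α) * (x ^ α * smoothZeta α y / Real.sqrt (2 * Real.pi * saddlePhi₂ α y))) ^ 2 *
          (x ^ α * smoothZeta α y / Real.sqrt (2 * Real.pi * saddlePhi₂ α y))) * (1 / 2 : ℝ) ^ 32 := by
  -- thresholds
  set T1 : ℝ := 3 * 2 ^ 78 * C ^ 2 * C' * Cs ^ 3 + 1 with hT1
  set T3 : ℝ := 384 * Real.sqrt (3 * ((K : ℝ) + 1)) * 2 ^ 78 * C ^ 2 + 1 with hT3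
  refine ⟨max (max (max 2 (1 / Cs + 1)) (max T1 T3))
      (max (max (((2 * K + 42 + 2 : ℕ).factorial : ℝ) / (9 / 100)) ((656 * 2 ^ 78 * C ^ 2) / (9 / 100 : ℝ) ^ (2 * K + 42 + 1)))
        (max (((38 + 2 : ℕ).factorial : ℝ) / (99 / 100)) ((2 ^ 78 * C ^ 2) / (99 / 100 : ℝ) ^ (38 + 1)))),
    fun x y α Ψ hL hx hy2 hly1 hly hyK' hα0 hα1 hαlo hφ hup hΨ0 hΨle hMxge => ?_⟩
  set L : ℝ := Real.log x with hLdef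
  have hL2 : 2 ≤ L := le_trans ((le_max_left _ _).trans ((le_max_left _ _).trans (le_max_left _ _))) hL
  have hLCs : 1 / Cs + 1 ≤ L := le_trans ((le_max_right _ _).trans ((le_max_left _ _).trans (le_max_left _ _))) hL
  have hLT1 : T1 ≤ L := le_trans ((le_max_left _ _).trans ((le_max_right _ _).trans (le_max_left _ _))) hL
  have hLT3 : T3 ≤ L := le_trans ((le_max_right _ _).trans ((le_max_right _ _).trans (le_max_left _ _))) hL
  have hLa1 : (((2 * K + 42 + 2 : ℕ).factorial : ℝ) / (9 / 100)) ≤ L :=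
    le_trans ((le_max_left _ _).trans ((le_max_left _ _).trans (le_max_right _ _))) hL
  have hLa2 : (656 * 2 ^ 78 * C ^ 2) / (9 / 100 : ℝ) ^ (2 * K + 42 + 1) ≤ L :=
    le_trans ((le_max_right _ _).trans ((le_max_left _ _).trans (le_max_right _ _))) hL
  have hLb1 : (((38 + 2 : ℕ).factorial : ℝ) / (99 / 100)) ≤ L :=
    le_trans ((le_max_left _ _).trans ((le_max_right _ _).trans (le_max_right _ _))) hL
  have hLb2 : (2 ^ 78 * C ^ 2) / (99 / 100 : ℝ) ^ (38 + 1) ≤ L :=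
    le_trans ((le_max_right _ _).trans ((le_max_right _ _).trans (le_max_right _ _))) hL
  have hL1 : 1 ≤ L := by linarith
  have hL0 : 0 < L := by linarith
  have hπ := Real.pi_pos
  have hφ0 : 0 < saddlePhi₂ α y := saddlePhi₂_pos hy2 hα0
  have hζ : 0 < smoothZeta α y := smoothZeta_pos hα0
  have hY0 : (0 : ℝ) < y := by exact_mod_cast (show 0 < y by omega)
  set Mx : ℝ := x ^ α * smoothZeta α y / Real.sqrt (2 * Real.pi * saddlePhi₂ α y) with hMx
  have hMx0 : 0 < Mx := by rw [hMx]; exact div_pos (by positivity) (Real.sqrt_pos.mpr (by positivity))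
  set P : ℝ := x ^ α * (smoothZeta α y / Real.sqrt (saddlePhi₂ α y)) with hPdef
  have hP : P = Real.sqrt (2 * π) * Mx := by
    have hsm : Real.sqrt (2 * π * saddlePhi₂ α y) = Real.sqrt (2 * π) * Real.sqrt (saddlePhi₂ α y) :=
      Real.sqrt_mul (by positivity) _
    rw [hPdef, hMx, hsm]
    have : 0 < Real.sqrt (2 * π) := Real.sqrt_pos.mpr (by positivity)
    have : 0 < Real.sqrt (saddlePhi₂ α y) := Real.sqrt_pos.mpr hφ0
    field_simp
  have hP0 : 0 ≤ P := by rw [hP]; positivity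
  have hP3 : P ≤ 3 * Mx := by rw [hP]; exact mul_le_mul_of_nonneg_right sqrt_two_pi_le_three hMx0.le
  have hxζ : x ^ α * smoothZeta α y = Mx * Real.sqrt (2 * π * saddlePhi₂ α y) := rpow_mul_zeta_eq hφ0
  have hsq := sqrt_two_pi_phi_le (K := K) hL1 hφ0.le hφ hly
  set D : ℝ := (2 ^ 38 * C * L ^ 19) ^ 2 with hD
  have hD0 : 0 < D := by positivity
  have hD4 : 4 * D = 2 ^ 78 * C ^ 2 * L ^ 38 := by rw [hD]; ring
  have hx99 : x ^ ((99 : ℝ) / 100) = Real.exp (99 / 100 * L) := by rw [hLdef, Real.rpow_def_of_pos hx]; ring_nf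
  have hx09 : x ^ ((9 : ℝ) / 100) = Real.exp (9 / 100 * L) := by rw [hLdef, Real.rpow_def_of_pos hx]; ring_nf
  -- ### (iv) `4D ≤ x^{0.99} ≤ Mx`
  have h4D : 4 * D ≤ Mx := by
    rw [hD4]
    have h := const_mul_pow_le_exp_mul 38 (a := 99 / 100) (A := 2 ^ 78 * C ^ 2) (by norm_num) hLb1 hLb2
    rw [← hx99] at h
    exact h.trans hMxge
  have hterm4 : (1 : ℝ) ≤ Mx / (4 * D) := by rw [le_div_iff₀ (by positivity)]; linarith
  -- ### (iii) `32Ψ/(Λ/2)² ≤ Mx/(4D)`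
  have hterm3 : 32 * Ψ / (L ^ 100 / 2) ^ 2 ≤ Mx / (4 * D) := by
    have e1 : 32 * Ψ / (L ^ 100 / 2) ^ 2 = 128 * Ψ / L ^ 200 := by field_simp; ring
    rw [e1, hD4, div_le_div_iff₀ (by positivity) (by positivity)]
    have hΨ' : Ψ ≤ Mx * (3 * Real.sqrt (3 * ((K : ℝ) + 1)) * L) :=
      hΨle.trans (hxζ ▸ mul_le_mul_of_nonneg_left hsq hMx0.le)
    -- `128 Ψ · 2^78 C² L^38 ≤ 128 · Mx · 3√(3(K+1)) L · 2^78 C² L^38 ≤ Mx L^200`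
    have hs0 : 0 ≤ Real.sqrt (3 * ((K : ℝ) + 1)) := Real.sqrt_nonneg _
    have hpow : (384 * Real.sqrt (3 * ((K : ℝ) + 1)) * 2 ^ 78 * C ^ 2) * L ^ 39 ≤ L ^ 200 := by
      have hT3' : 384 * Real.sqrt (3 * ((K : ℝ) + 1)) * 2 ^ 78 * C ^ 2 ≤ L := by rw [hT3] at hLT3; linarith
      calc (384 * Real.sqrt (3 * ((K : ℝ) + 1)) * 2 ^ 78 * C ^ 2) * L ^ 39 ≤ L * L ^ 39 :=
            mul_le_mul_of_nonneg_right hT3' (by positivity)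
        _ = L ^ 40 := by ring
        _ ≤ L ^ 200 := pow_le_pow_right₀ hL1 (by norm_num)
    calc 128 * Ψ * (2 ^ 78 * C ^ 2 * L ^ 38) ≤ 128 * (Mx * (3 * Real.sqrt (3 * ((K : ℝ) + 1)) * L)) * (2 ^ 78 * C ^ 2 * L ^ 38) :=
          mul_le_mul_of_nonneg_right (mul_le_mul_of_nonneg_left hΨ' (by norm_num)) (by positivity)
      _ = Mx * ((384 * Real.sqrt (3 * ((K : ℝ) + 1)) * 2 ^ 78 * C ^ 2) * L ^ 39) := by ring
      _ ≤ Mx * L ^ 200 := mul_le_mul_of_nonneg_left hpow hMx0.le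
  -- ### (ii) `164(1+L)² y² x^{0.9} ≤ Mx/(4D)`
  have hterm2 : 164 * (1 + L) ^ 2 * (y : ℝ) ^ 2 * x ^ (9 / 10 : ℝ) ≤ Mx / (4 * D) := by
    rw [hD4, le_div_iff₀ (by positivity)]
    have h1L : (1 + L) ^ 2 ≤ 4 * L ^ 2 := by nlinarith
    have hy2' : (y : ℝ) ^ 2 ≤ (L ^ (K + 1)) ^ 2 := pow_le_pow_left₀ hY0.le hyK' 2
    have hx9 : 0 ≤ x ^ (9 / 10 : ℝ) := Real.rpow_nonneg hx.le _
    have hA : 164 * (1 + L) ^ 2 * (y : ℝ) ^ 2 * x ^ (9 / 10 : ℝ) * (2 ^ 78 * C ^ 2 * L ^ 38) ≤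
        (656 * 2 ^ 78 * C ^ 2) * L ^ (2 * K + 42) * x ^ (9 / 10 : ℝ) := by
      have : 164 * (1 + L) ^ 2 * (y : ℝ) ^ 2 ≤ 164 * (4 * L ^ 2) * (L ^ (K + 1)) ^ 2 :=
        mul_le_mul (mul_le_mul_of_nonneg_left h1L (by norm_num)) hy2' (by positivity) (by positivity)
      calc 164 * (1 + L) ^ 2 * (y : ℝ) ^ 2 * x ^ (9 / 10 : ℝ) * (2 ^ 78 * C ^ 2 * L ^ 38)
          = (164 * (1 + L) ^ 2 * (y : ℝ) ^ 2) * (x ^ (9 / 10 : ℝ) * (2 ^ 78 * C ^ 2 * L ^ 38)) := by ring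
        _ ≤ (164 * (4 * L ^ 2) * (L ^ (K + 1)) ^ 2) * (x ^ (9 / 10 : ℝ) * (2 ^ 78 * C ^ 2 * L ^ 38)) :=
            mul_le_mul_of_nonneg_right this (by positivity)
        _ = (656 * 2 ^ 78 * C ^ 2) * L ^ (2 * K + 42) * x ^ (9 / 10 : ℝ) := by ring
    refine hA.trans ?_
    have h := const_mul_pow_le_exp_mul (2 * K + 42) (a := 9 / 100) (A := 656 * 2 ^ 78 * C ^ 2) (by norm_num) hLa1 hLa2
    rw [← hx09] at h
    have hprod : x ^ (9 / 10 : ℝ) * x ^ ((9 : ℝ) / 100) = x ^ ((99 : ℝ) / 100) := by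
      rw [← Real.rpow_add hx]; norm_num
    calc (656 * 2 ^ 78 * C ^ 2) * L ^ (2 * K + 42) * x ^ (9 / 10 : ℝ) ≤ x ^ ((9 : ℝ) / 100) * x ^ (9 / 10 : ℝ) :=
          mul_le_mul_of_nonneg_right h hx9
      _ = x ^ ((99 : ℝ) / 100) := by rw [mul_comm, hprod]
      _ ≤ Mx := hMxge
  -- ### (i) the main minor term
  have hterm1 : C' * L ^ 3 * (y : ℝ) ^ (5 / 2 * (1 - α)) * (L ^ 100 / 2) ^ (-(1 / 2 : ℝ) + 3 / 2 * (1 - α)) * P ≤ Mx / (4 * D) := by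
    -- `y^{1-α} ≤ Cs L²`
    set u : ℝ := L / Real.log y with hu
    have hu0 : 0 ≤ u := by positivity
    have huL : u ≤ L := by rw [hu]; exact div_le_self hL0.le hly1
    have hlogu : Real.log (u + 1) ≤ L := le_trans (Real.log_le_sub_one_of_pos (by linarith)) (by linarith)
    have hY1α : (y : ℝ) ^ (1 - α) ≤ Cs * L ^ 2 := by
      refine hup.trans ?_
      have : u * Real.log (u + 1) ≤ L * L :=
        mul_le_mul huL hlogu (Real.log_nonneg (by linarith)) hL0.le
      nlinarith
    have ht1 : 1 ≤ Cs * L ^ 2 := by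
      have h1 : 1 / Cs ≤ L := by linarith
      have : 1 ≤ Cs * L := by rw [div_le_iff₀' hCs] at h1; exact h1
      nlinarith
    have hY52 : (y : ℝ) ^ (5 / 2 * (1 - α)) ≤ Cs ^ 3 * L ^ 6 := by
      rw [mul_comm (5 / 2 : ℝ), Real.rpow_mul hY0.le]
      calc ((y : ℝ) ^ (1 - α)) ^ (5 / 2 : ℝ) ≤ (Cs * L ^ 2) ^ (5 / 2 : ℝ) :=
            Real.rpow_le_rpow (Real.rpow_nonneg hY0.le _) hY1α (by norm_num)
        _ ≤ (Cs * L ^ 2) ^ (3 : ℝ) := Real.rpow_le_rpow_of_exponent_le ht1 (by norm_num)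
        _ = Cs ^ 3 * L ^ 6 := by
            rw [show (3 : ℝ) = ((3 : ℕ) : ℝ) by norm_num, Real.rpow_natCast]; ring
    -- `(Λ/2)^e ≤ (L^49)⁻¹`
    have hB : L ^ 99 ≤ L ^ 100 / 2 := by
      rw [le_div_iff₀ (by norm_num)]
      calc L ^ 99 * 2 ≤ L ^ 99 * L := mul_le_mul_of_nonneg_left hL2 (by positivity)
        _ = L ^ 100 := by ring
    have hB1 : 1 ≤ L ^ 100 / 2 := le_trans (one_le_pow₀ hL1) hB
    have hexp : -(1 / 2 : ℝ) + 3 / 2 * (1 - α) ≤ -(499 / 1000) := by linarith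
    have hΛe : (L ^ 100 / 2) ^ (-(1 / 2 : ℝ) + 3 / 2 * (1 - α)) ≤ (L ^ 49)⁻¹ := by
      calc (L ^ 100 / 2) ^ (-(1 / 2 : ℝ) + 3 / 2 * (1 - α)) ≤ (L ^ 100 / 2) ^ (-(499 / 1000) : ℝ) :=
            Real.rpow_le_rpow_of_exponent_le hB1 hexp
        _ ≤ (L ^ 99) ^ (-(499 / 1000) : ℝ) := Real.rpow_le_rpow_of_nonpos (by positivity) hB (by norm_num)
        _ = L ^ ((99 : ℝ) * (-(499 / 1000))) := by rw [← Real.rpow_natCast L 99, ← Real.rpow_mul hL0.le]; norm_num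
        _ ≤ L ^ (-(49 : ℝ)) := Real.rpow_le_rpow_of_exponent_le hL1 (by norm_num)
        _ = (L ^ 49)⁻¹ := by rw [Real.rpow_neg hL0.le, show (49 : ℝ) = ((49 : ℕ) : ℝ) by norm_num, Real.rpow_natCast]
    have hΛe0 : 0 ≤ (L ^ 100 / 2) ^ (-(1 / 2 : ℝ) + 3 / 2 * (1 - α)) := Real.rpow_nonneg (by positivity) _
    have hY520 : 0 ≤ (y : ℝ) ^ (5 / 2 * (1 - α)) := Real.rpow_nonneg hY0.le _
    -- assemble: `≤ C' L³ · Cs³ L⁶ · (L^49)⁻¹ · 3Mx = 3C'Cs³ Mx/L^{40}`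
    have hA : C' * L ^ 3 * (y : ℝ) ^ (5 / 2 * (1 - α)) * (L ^ 100 / 2) ^ (-(1 / 2 : ℝ) + 3 / 2 * (1 - α)) * P ≤
        C' * L ^ 3 * (Cs ^ 3 * L ^ 6) * (L ^ 49)⁻¹ * (3 * Mx) := by
      apply mul_le_mul _ hP3 hP0 (by positivity)
      apply mul_le_mul _ hΛe hΛe0 (by positivity)
      exact mul_le_mul_of_nonneg_left hY52 (by positivity)
    refine hA.trans ?_
    rw [hD4, le_div_iff₀ (by positivity)]
    have hT1' : 3 * 2 ^ 78 * C ^ 2 * C' * Cs ^ 3 ≤ L := by rw [hT1] at hLT1; linarith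
    have e : C' * L ^ 3 * (Cs ^ 3 * L ^ 6) * (L ^ 49)⁻¹ * (3 * Mx) * (2 ^ 78 * C ^ 2 * L ^ 38) =
        Mx * ((3 * 2 ^ 78 * C ^ 2 * C' * Cs ^ 3) * L ^ 47) * (L ^ 49)⁻¹ := by ring
    rw [e]
    have : (3 * 2 ^ 78 * C ^ 2 * C' * Cs ^ 3) * L ^ 47 ≤ L ^ 49 := by
      calc (3 * 2 ^ 78 * C ^ 2 * C' * Cs ^ 3) * L ^ 47 ≤ L * L ^ 47 := mul_le_mul_of_nonneg_right hT1' (by positivity)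
        _ = L ^ 48 := by ring
        _ ≤ L ^ 49 := pow_le_pow_right₀ hL1 (by norm_num)
    calc Mx * ((3 * 2 ^ 78 * C ^ 2 * C' * Cs ^ 3) * L ^ 47) * (L ^ 49)⁻¹ ≤ Mx * L ^ 49 * (L ^ 49)⁻¹ := by
          apply mul_le_mul_of_nonneg_right (mul_le_mul_of_nonneg_left this hMx0.le) (by positivity)
      _ = Mx := by field_simp
  -- ### the bound for `Bsup`
  have hBsup : C' * L ^ 3 * (y : ℝ) ^ (5 / 2 * (1 - α)) * (L ^ 100 / 2) ^ (-(1 / 2 : ℝ) + 3 / 2 * (1 - α)) * P +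
      164 * (1 + L) ^ 2 * (y : ℝ) ^ 2 * x ^ (9 / 10 : ℝ) + 32 * Ψ / (L ^ 100 / 2) ^ 2 + 1 ≤ Mx / D := by
    have : Mx / D = 4 * (Mx / (4 * D)) := by field_simp
    rw [this]; linarith
  have hBsup0 : 0 ≤ C' * L ^ 3 * (y : ℝ) ^ (5 / 2 * (1 - α)) * (L ^ 100 / 2) ^ (-(1 / 2 : ℝ) + 3 / 2 * (1 - α)) * P +
      164 * (1 + L) ^ 2 * (y : ℝ) ^ 2 * x ^ (9 / 10 : ℝ) + 32 * Ψ / (L ^ 100 / 2) ^ 2 + 1 := by positivity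
  -- ### the final chain
  have hsqrtB : Real.sqrt (C' * L ^ 3 * (y : ℝ) ^ (5 / 2 * (1 - α)) * (L ^ 100 / 2) ^ (-(1 / 2 : ℝ) + 3 / 2 * (1 - α)) * P +
      164 * (1 + L) ^ 2 * (y : ℝ) ^ 2 * x ^ (9 / 10 : ℝ) + 32 * Ψ / (L ^ 100 / 2) ^ 2 + 1) ≤
      Real.sqrt Mx / (2 ^ 38 * C * L ^ 19) := by
    calc _ ≤ Real.sqrt (Mx / D) := Real.sqrt_le_sqrt hBsup
      _ = Real.sqrt Mx / Real.sqrt D := Real.sqrt_div' Mx (by positivity)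
      _ = Real.sqrt Mx / (2 ^ 38 * C * L ^ 19) := by rw [hD, Real.sqrt_sq (by positivity)]
  have hP52 : P ^ ((5 : ℝ) / 2) ≤ 16 * Mx ^ ((5 : ℝ) / 2) := by
    calc P ^ ((5 : ℝ) / 2) ≤ (3 * Mx) ^ ((5 : ℝ) / 2) := Real.rpow_le_rpow hP0 hP3 (by norm_num)
      _ = 3 ^ ((5 : ℝ) / 2) * Mx ^ ((5 : ℝ) / 2) := Real.mul_rpow (by norm_num) hMx0.le
      _ ≤ 16 * Mx ^ ((5 : ℝ) / 2) := mul_le_mul_of_nonneg_right three_rpow_five_halves_le (Real.rpow_nonneg hMx0.le _)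
  have hMx3 : Mx ^ ((5 : ℝ) / 2) * Real.sqrt Mx = Mx ^ 3 := by
    rw [Real.sqrt_eq_rpow, ← Real.rpow_add hMx0, show (5 : ℝ) / 2 + 1 / 2 = ((3 : ℕ) : ℝ) by norm_num, Real.rpow_natCast]
  have h2α : 1 / 2 ≤ (2 : ℝ) ^ (-α) := by
    rw [Real.rpow_neg (by norm_num), one_div]
    apply inv_anti₀ (by positivity)
    calc (2 : ℝ) ^ α ≤ 2 ^ (1 : ℝ) := Real.rpow_le_rpow_of_exponent_le (by norm_num) hα1
      _ = 2 := Real.rpow_one 2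
  have hRHS : Mx ^ 3 * (1 / 2 : ℝ) ^ 34 ≤ (((2 : ℝ) ^ (-α) * Mx) ^ 2 * Mx) * (1 / 2 : ℝ) ^ 32 := by
    have h4 : (1 / 2 : ℝ) ^ 2 ≤ ((2 : ℝ) ^ (-α)) ^ 2 := pow_le_pow_left₀ (by norm_num) h2α 2
    have : Mx ^ 3 * (1 / 2 : ℝ) ^ 34 = ((1 / 2 : ℝ) ^ 2 * Mx ^ 3) * (1 / 2 : ℝ) ^ 32 := by ring
    rw [this, show (((2 : ℝ) ^ (-α) * Mx) ^ 2 * Mx) = ((2 : ℝ) ^ (-α)) ^ 2 * Mx ^ 3 by ring]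
    apply mul_le_mul_of_nonneg_right _ (by positivity)
    exact mul_le_mul_of_nonneg_right h4 (by positivity)
  refine le_trans ?_ hRHS
  calc C * L ^ (19 : ℕ) * P ^ ((5 : ℝ) / 2) * Real.sqrt (C' * L ^ 3 * (y : ℝ) ^ (5 / 2 * (1 - α)) *
        (L ^ 100 / 2) ^ (-(1 / 2 : ℝ) + 3 / 2 * (1 - α)) * P +
        164 * (1 + L) ^ 2 * (y : ℝ) ^ 2 * x ^ (9 / 10 : ℝ) + 32 * Ψ / (L ^ 100 / 2) ^ 2 + 1)
      ≤ C * L ^ (19 : ℕ) * (16 * Mx ^ ((5 : ℝ) / 2)) * (Real.sqrt Mx / (2 ^ 38 * C * L ^ 19)) :=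
        mul_le_mul (mul_le_mul_of_nonneg_left hP52 (by positivity)) hsqrtB (Real.sqrt_nonneg _) (by positivity)
    _ = 16 * (Mx ^ ((5 : ℝ) / 2) * Real.sqrt Mx) / 2 ^ 38 := by field_simp
    _ = Mx ^ 3 * (1 / 2 : ℝ) ^ 34 := by rw [hMx3]; ring


/-! ### The regime along `(log x)^K ≤ y ≤ (log x)^{K+1}` -/

set_option maxHeartbeats 1600000 in
/-- **The polylogarithmic regime.** For `K ≥ 4000`, `0 < θ ≤ 1/5` with `Kθ ≥ 820`, there is `L₀`
such that for `L = log x ≥ L₀` and `L^K ≤ y ≤ L^{K+1}` all the range hypotheses of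
`count_lower_bound` hold (with `Λ = L^{100}`). [cite: Harper2016, §5] -/
theorem regime_facts {K : ℕ} {θ : ℝ} (hK : 4000 ≤ K) (hθ0 : 0 < θ) (hθ : θ ≤ 1 / 5) (hKθ : 820 ≤ (K : ℝ) * θ) :
    ∃ L₀ : ℝ, ∀ (x : ℝ) (y : ℕ), L₀ ≤ Real.log x → 0 < x → Real.log x ^ K ≤ y → (y : ℝ) ≤ Real.log x ^ (K + 1) →
      Real.log x ^ 8 ≤ y ∧ (y : ℝ) ^ 200 ≤ x ∧ Real.log y ≤ 1 / 2 * Real.log x ^ (1 / 6 : ℝ) ∧ 25 ≤ Real.log y ∧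
      1 ≤ Real.log y ∧ Real.log y ≤ ((K : ℝ) + 1) * Real.log (Real.log x) ∧ 2 ≤ y ∧
      (2 : ℝ) ^ 40 ≤ Real.log x ^ 100 ∧ (Real.log x ^ 100) ^ 8 ≤ (y : ℝ) ∧
      Real.log x ^ 100 / 2 ≤ x ^ (1 / 10 : ℝ) ∧ (y : ℝ) ≤ x ∧ Real.log x ^ 100 ≤ (y : ℝ) ^ θ ∧
      40 * ((y : ℝ) ^ (1 - θ) + 1) ≤ (y : ℝ) ^ (1 - θ / 2) ∧ (y : ℝ) ^ θ + 1 ≤ (y : ℝ) ^ (1 - θ / 2) ∧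
      3 * (y : ℝ) ^ (1 - θ / 2) ≤ y := by
  refine ⟨max (max 3 ((24 * ((K : ℝ) + 1)) ^ (12 : ℕ)))
      (max (((200 * (K + 1) + 1 : ℕ).factorial : ℝ)) (max (((100 + 2 : ℕ).factorial : ℝ) / (1 / 10)) ((1 : ℝ) / (1 / 10 : ℝ) ^ (100 + 1)))),
    fun x y hL hx hyK hyK' => ?_⟩
  set L : ℝ := Real.log x with hLdef
  have hL3 : 3 ≤ L := le_trans ((le_max_left _ _).trans (le_max_left _ _)) hL
  have hL24 : (24 * ((K : ℝ) + 1)) ^ (12 : ℕ) ≤ L := le_trans ((le_max_right _ _).trans (le_max_left _ _)) hL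
  have hLfac : (((200 * (K + 1) + 1 : ℕ).factorial : ℝ)) ≤ L := le_trans ((le_max_left _ _).trans (le_max_right _ _)) hL
  have hLc1 : (((100 + 2 : ℕ).factorial : ℝ) / (1 / 10)) ≤ L := le_trans ((le_max_left _ _).trans ((le_max_right _ _).trans (le_max_right _ _))) hL
  have hLc2 : ((1 : ℝ) / (1 / 10 : ℝ) ^ (100 + 1)) ≤ L := le_trans ((le_max_right _ _).trans ((le_max_right _ _).trans (le_max_right _ _))) hL
  have hL1 : 1 ≤ L := by linarith
  have hL0 : 0 < L := by linarith
  have hK1 : 1 ≤ K := by omega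
  set Y : ℝ := (y : ℝ) with hY
  have hLK : L ≤ L ^ K := le_self_pow₀ hL1 (by omega)
  have hY3 : 3 ≤ Y := by linarith [hLK.trans hyK]
  have hY1 : 1 ≤ Y := by linarith
  have hY0 : 0 < Y := by linarith
  have hlogL1 : 1 ≤ Real.log L := by
    rw [Real.le_log_iff_exp_le hL0]; have := Real.exp_one_lt_d9; linarith
  have hlogYle : Real.log Y ≤ ((K : ℝ) + 1) * Real.log L := by
    have := Real.log_le_log hY0 hyK'
    rw [Real.log_pow] at this; push_cast at this; exact this
  have hlogYge : (K : ℝ) * Real.log L ≤ Real.log Y := by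
    have := Real.log_le_log (by positivity) hyK
    rwa [Real.log_pow] at this
  have hK25 : (25 : ℝ) ≤ K := by exact_mod_cast (show 25 ≤ K by omega)
  have h25 : 25 ≤ Real.log Y := le_trans (by nlinarith) hlogYge
  have hx' : Real.exp L = x := by rw [hLdef]; exact Real.exp_log hx
  refine ⟨?_, ?_, ?_, h25, by linarith, hlogYle, ?_, ?_, ?_, ?_, ?_, ?_, ?_, ?_, ?_⟩
  · -- `L^8 ≤ y`
    exact le_trans (pow_le_pow_right₀ hL1 (by omega)) hyK
  · -- `y^200 ≤ x`
    calc Y ^ 200 ≤ (L ^ (K + 1)) ^ 200 := pow_le_pow_left₀ hY0.le hyK' 200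
      _ = L ^ (200 * (K + 1)) := by rw [← pow_mul, mul_comm]
      _ ≤ Real.exp L := pow_le_exp_of_factorial_le _ hLfac
      _ = x := hx'
  · -- `log y ≤ ½ L^{1/6}`
    have hlog12 : Real.log L ≤ 12 * L ^ (1 / 12 : ℝ) := by
      have := log_le_inv_mul_rpow hL0.le (show (0 : ℝ) < 1 / 12 by norm_num); norm_num at this; linarith
    have hL12 : 24 * ((K : ℝ) + 1) ≤ L ^ (1 / 12 : ℝ) := by
      have h := Real.rpow_le_rpow (by positivity) hL24 (show (0 : ℝ) ≤ 1 / 12 by norm_num)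
      rw [← Real.rpow_natCast, ← Real.rpow_mul (by positivity)] at h; norm_num at h; exact h
    have hsq : L ^ (1 / 12 : ℝ) * L ^ (1 / 12 : ℝ) = L ^ (1 / 6 : ℝ) := by rw [← Real.rpow_add hL0]; norm_num
    have h0 : 0 ≤ L ^ (1 / 12 : ℝ) := Real.rpow_nonneg hL0.le _
    calc Real.log Y ≤ ((K : ℝ) + 1) * Real.log L := hlogYle
      _ ≤ ((K : ℝ) + 1) * (12 * L ^ (1 / 12 : ℝ)) := mul_le_mul_of_nonneg_left hlog12 (by positivity)
      _ = 1 / 2 * ((24 * ((K : ℝ) + 1)) * L ^ (1 / 12 : ℝ)) := by ring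
      _ ≤ 1 / 2 * (L ^ (1 / 12 : ℝ) * L ^ (1 / 12 : ℝ)) := by
          apply mul_le_mul_of_nonneg_left (mul_le_mul_of_nonneg_right hL12 h0) (by norm_num)
      _ = 1 / 2 * L ^ (1 / 6 : ℝ) := by rw [hsq]
  · -- `2 ≤ y`
    have : (2 : ℝ) ≤ y := by linarith
    exact_mod_cast this
  · -- `2^40 ≤ L^100`
    calc (2 : ℝ) ^ 40 ≤ 3 ^ 100 := by norm_num
      _ ≤ L ^ 100 := pow_le_pow_left₀ (by norm_num) hL3 100
  · -- `Λ^8 ≤ y`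
    calc (L ^ 100) ^ 8 = L ^ 800 := by ring
      _ ≤ L ^ K := pow_le_pow_right₀ hL1 (by omega)
      _ ≤ Y := hyK
  · -- `L^100/2 ≤ x^{1/10} = exp(L/10)`
    have h := const_mul_pow_le_exp_mul 100 (a := 1 / 10) (A := 1) (by norm_num) hLc1 hLc2
    rw [one_mul] at h
    have hx10 : x ^ (1 / 10 : ℝ) = Real.exp (1 / 10 * L) := by rw [hLdef, Real.rpow_def_of_pos hx]; ring_nf
    rw [hx10]
    have : L ^ 100 / 2 ≤ L ^ 100 := by linarith [pow_nonneg hL0.le 100]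
    exact this.trans h
  · -- `y ≤ x`
    calc Y ≤ Y ^ 200 := le_self_pow₀ hY1 (by norm_num)
      _ ≤ (L ^ (K + 1)) ^ 200 := pow_le_pow_left₀ hY0.le hyK' 200
      _ = L ^ (200 * (K + 1)) := by rw [← pow_mul, mul_comm]
      _ ≤ Real.exp L := pow_le_exp_of_factorial_le _ hLfac
      _ = x := hx'
  · -- `L^100 ≤ y^θ`
    have h1 : (L ^ K) ^ θ ≤ Y ^ θ := Real.rpow_le_rpow (by positivity) hyK hθ0.le
    have h2 : (L ^ K : ℝ) ^ θ = L ^ ((K : ℝ) * θ) := by rw [← Real.rpow_natCast L K, ← Real.rpow_mul hL0.le]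
    have h3 : L ^ (100 : ℕ) ≤ L ^ ((K : ℝ) * θ) := by
      rw [← Real.rpow_natCast L 100]
      exact Real.rpow_le_rpow_of_exponent_le hL1 (by push_cast; linarith)
    linarith [h2 ▸ h1]
  · -- the three size conditions from `t = y^{θ/2} ≥ 80`
    have ht : 80 ≤ Y ^ (θ / 2) := by
      have h1 : (L ^ K) ^ (θ / 2) ≤ Y ^ (θ / 2) := Real.rpow_le_rpow (by positivity) hyK (by linarith)
      have h2 : (L ^ K : ℝ) ^ (θ / 2) = L ^ ((K : ℝ) * (θ / 2)) := by rw [← Real.rpow_natCast L K, ← Real.rpow_mul hL0.le]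
      have h3 : L ^ (1 : ℕ) ≤ L ^ ((K : ℝ) * (θ / 2)) := by
        rw [← Real.rpow_natCast L 1]
        exact Real.rpow_le_rpow_of_exponent_le hL1 (by push_cast; nlinarith)
      have h80 : (80 : ℝ) ≤ L ^ (1 : ℕ) := by
        rw [pow_one]
        have : (24 * ((K : ℝ) + 1)) ^ (12 : ℕ) ≥ 24 * ((K : ℝ) + 1) := le_self_pow₀ (by nlinarith) (by norm_num)
        nlinarith
      linarith [h2 ▸ h1]
    have e1 : Y ^ (1 - θ / 2) = Y ^ (1 - θ) * Y ^ (θ / 2) := by rw [← Real.rpow_add hY0]; ring_nf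
    have h1θ : 1 ≤ Y ^ (1 - θ) := Real.one_le_rpow hY1 (by linarith)
    rw [e1]; nlinarith
  · have e2 : Y ^ (1 - θ / 2) = Y ^ θ * Y ^ (1 - 3 * θ / 2) := by rw [← Real.rpow_add hY0]; ring_nf
    have ht' : 80 ≤ Y ^ (1 - 3 * θ / 2) := by
      have h1 : (L ^ K) ^ (1 - 3 * θ / 2) ≤ Y ^ (1 - 3 * θ / 2) := Real.rpow_le_rpow (by positivity) hyK (by linarith)
      have h2 : (L ^ K : ℝ) ^ (1 - 3 * θ / 2) = L ^ ((K : ℝ) * (1 - 3 * θ / 2)) := by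
        rw [← Real.rpow_natCast L K, ← Real.rpow_mul hL0.le]
      have h3 : L ^ (1 : ℕ) ≤ L ^ ((K : ℝ) * (1 - 3 * θ / 2)) := by
        rw [← Real.rpow_natCast L 1]
        refine Real.rpow_le_rpow_of_exponent_le hL1 ?_
        push_cast
        have : (K : ℝ) * (1 - 3 * θ / 2) ≥ (K : ℝ) * (7 / 10) := mul_le_mul_of_nonneg_left (by linarith) (by positivity)
        nlinarith
      have h80 : (80 : ℝ) ≤ L ^ (1 : ℕ) := by
        rw [pow_one]
        have : (24 * ((K : ℝ) + 1)) ^ (12 : ℕ) ≥ 24 * ((K : ℝ) + 1) := le_self_pow₀ (by nlinarith) (by norm_num)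
        nlinarith
      linarith [h2 ▸ h1]
    have h1θ : 1 ≤ Y ^ θ := Real.one_le_rpow hY1 hθ0.le
    rw [e2]; nlinarith
  · have e3 : Y = Y ^ (1 - θ / 2) * Y ^ (θ / 2) := by rw [← Real.rpow_add hY0]; norm_num
    have ht : 3 ≤ Y ^ (θ / 2) := by
      have h1 : (L ^ K) ^ (θ / 2) ≤ Y ^ (θ / 2) := Real.rpow_le_rpow (by positivity) hyK (by linarith)
      have h2 : (L ^ K : ℝ) ^ (θ / 2) = L ^ ((K : ℝ) * (θ / 2)) := by rw [← Real.rpow_natCast L K, ← Real.rpow_mul hL0.le]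
      have h3 : L ^ (1 : ℕ) ≤ L ^ ((K : ℝ) * (θ / 2)) := by
        rw [← Real.rpow_natCast L 1]
        exact Real.rpow_le_rpow_of_exponent_le hL1 (by push_cast; nlinarith)
      rw [pow_one] at h3
      linarith [h2 ▸ h1]
    have h0 : 0 < Y ^ (1 - θ / 2) := by positivity
    have key : 3 * Y ^ (1 - θ / 2) ≤ Y ^ (1 - θ / 2) * Y ^ (θ / 2) := by nlinarith
    rw [← e3] at key; exact key

/-! ### From the weighted count to pairs -/

/-- `w ≤ 1/16` on `[0,1]`. [folklore] -/
theorem wt_le_sixteenth {v : ℝ} (hv0 : 0 ≤ v) (hv1 : v ≤ 1) : wt v ≤ 1 / 16 := by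
  unfold wt
  have h : v * (1 - v) ≤ 1 / 4 := by nlinarith [sq_nonneg (v - 1 / 2)]
  have h0 : 0 ≤ v * (1 - v) := mul_nonneg hv0 (by linarith)
  nlinarith

/-- **`4096 𝒩_w ≤ #{(a,b) : a, b ∈ S(x/2,y), a + b ∈ S(x,y)}`.** [cite: Harper2016, §5] -/
theorem countW_le_card {x : ℝ} (hx : 0 < x) (y : ℕ) :
    4096 * (∑ a ∈ Finset.Icc 1 ⌊x⌋₊, ∑ b ∈ Finset.Icc 1 ⌊x⌋₊,
        (if a ∈ Nat.smoothNumbersUpTo ⌊x / 2⌋₊ (y + 1) then wt ((a : ℝ) / (x / 2)) else 0) *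
        (if b ∈ Nat.smoothNumbersUpTo ⌊x / 2⌋₊ (y + 1) then wt ((b : ℝ) / (x / 2)) else 0) *
        (if a + b ∈ Nat.smoothNumbersUpTo ⌊x⌋₊ (y + 1) then wt (((a + b : ℕ) : ℝ) / x) else 0)) ≤
      ((((Finset.Icc 1 ⌊x⌋₊) ×ˢ (Finset.Icc 1 ⌊x⌋₊)).filter (fun p : ℕ × ℕ =>
        p.1 ∈ Nat.smoothNumbersUpTo ⌊x / 2⌋₊ (y + 1) ∧ p.2 ∈ Nat.smoothNumbersUpTo ⌊x / 2⌋₊ (y + 1) ∧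
        p.1 + p.2 ∈ Nat.smoothNumbersUpTo ⌊x⌋₊ (y + 1))).card : ℝ) := by
  rw [← Finset.sum_product'
    (f := fun a b => (if a ∈ Nat.smoothNumbersUpTo ⌊x / 2⌋₊ (y + 1) then wt ((a : ℝ) / (x / 2)) else 0) *
        (if b ∈ Nat.smoothNumbersUpTo ⌊x / 2⌋₊ (y + 1) then wt ((b : ℝ) / (x / 2)) else 0) *
        (if a + b ∈ Nat.smoothNumbersUpTo ⌊x⌋₊ (y + 1) then wt (((a + b : ℕ) : ℝ) / x) else 0))]
  have hcount : ((((Finset.Icc 1 ⌊x⌋₊) ×ˢ (Finset.Icc 1 ⌊x⌋₊)).filter (fun p : ℕ × ℕ =>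
        p.1 ∈ Nat.smoothNumbersUpTo ⌊x / 2⌋₊ (y + 1) ∧ p.2 ∈ Nat.smoothNumbersUpTo ⌊x / 2⌋₊ (y + 1) ∧
        p.1 + p.2 ∈ Nat.smoothNumbersUpTo ⌊x⌋₊ (y + 1))).card : ℝ) =
      ∑ p ∈ (Finset.Icc 1 ⌊x⌋₊) ×ˢ (Finset.Icc 1 ⌊x⌋₊),
        (if (p.1 ∈ Nat.smoothNumbersUpTo ⌊x / 2⌋₊ (y + 1) ∧ p.2 ∈ Nat.smoothNumbersUpTo ⌊x / 2⌋₊ (y + 1) ∧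
          p.1 + p.2 ∈ Nat.smoothNumbersUpTo ⌊x⌋₊ (y + 1)) then (1 : ℝ) else 0) := by
    rw [Finset.sum_boole]
  rw [hcount, Finset.mul_sum]
  refine Finset.sum_le_sum fun p _ => ?_
  have hx2 : 0 < x / 2 := half_pos hx
  -- the three weights are in `[0, 1/16]` when present
  have hw₂ : ∀ a ∈ Nat.smoothNumbersUpTo ⌊x / 2⌋₊ (y + 1), 0 ≤ wt ((a : ℝ) / (x / 2)) ∧ wt ((a : ℝ) / (x / 2)) ≤ 1 / 16 := by
    intro a ha
    have hle : (a : ℝ) ≤ x / 2 := le_trans (by exact_mod_cast (Nat.mem_smoothNumbersUpTo.mp ha).1) (Nat.floor_le hx2.le)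
    exact ⟨wt_nonneg _, wt_le_sixteenth (by positivity) (by rw [div_le_one hx2]; exact hle)⟩
  have hw₃ : ∀ c ∈ Nat.smoothNumbersUpTo ⌊x⌋₊ (y + 1), 0 ≤ wt ((c : ℝ) / x) ∧ wt ((c : ℝ) / x) ≤ 1 / 16 := by
    intro c hc
    have hle : (c : ℝ) ≤ x := le_trans (by exact_mod_cast (Nat.mem_smoothNumbersUpTo.mp hc).1) (Nat.floor_le hx.le)
    exact ⟨wt_nonneg _, wt_le_sixteenth (by positivity) (by rw [div_le_one hx]; exact hle)⟩
  by_cases h1 : p.1 ∈ Nat.smoothNumbersUpTo ⌊x / 2⌋₊ (y + 1)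
  · by_cases h2 : p.2 ∈ Nat.smoothNumbersUpTo ⌊x / 2⌋₊ (y + 1)
    · by_cases h3 : p.1 + p.2 ∈ Nat.smoothNumbersUpTo ⌊x⌋₊ (y + 1)
      · rw [if_pos h1, if_pos h2, if_pos h3, if_pos ⟨h1, h2, h3⟩]
        obtain ⟨a0, a1⟩ := hw₂ p.1 h1
        obtain ⟨b0, b1⟩ := hw₂ p.2 h2
        obtain ⟨c0, c1⟩ := hw₃ (p.1 + p.2) h3
        have hab : wt ((p.1 : ℝ) / (x / 2)) * wt ((p.2 : ℝ) / (x / 2)) ≤ 1 / 16 * (1 / 16) :=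
          mul_le_mul a1 b1 b0 (by norm_num)
        have habc : wt ((p.1 : ℝ) / (x / 2)) * wt ((p.2 : ℝ) / (x / 2)) * wt (((p.1 + p.2 : ℕ) : ℝ) / x) ≤
            1 / 16 * (1 / 16) * (1 / 16) := by
          push_cast at c1 c0 ⊢
          exact mul_le_mul hab c1 c0 (by norm_num)
        linarith
      · rw [if_neg h3, mul_zero, mul_zero]; split_ifs <;> norm_num
    · rw [if_neg h2, mul_zero, zero_mul, mul_zero]; split_ifs <;> norm_num
  · rw [if_neg h1, zero_mul, zero_mul, mul_zero]; split_ifs <;> norm_num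


/-- The pairs counted by `𝒩_w` have `ab(a+b)` with all prime factors `≤ y ≤ (log X)^{K'}`.
[cite: Harper2016, §1 (remark after Cor. 1)] -/
theorem pairs_subset (X y K' : ℕ) (hy : (y : ℝ) ≤ Real.log X ^ K') :
    (↑(((Finset.Icc 1 ⌊(X : ℝ)⌋₊) ×ˢ (Finset.Icc 1 ⌊(X : ℝ)⌋₊)).filter (fun p : ℕ × ℕ =>
        p.1 ∈ Nat.smoothNumbersUpTo ⌊(X : ℝ) / 2⌋₊ (y + 1) ∧ p.2 ∈ Nat.smoothNumbersUpTo ⌊(X : ℝ) / 2⌋₊ (y + 1) ∧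
        p.1 + p.2 ∈ Nat.smoothNumbersUpTo ⌊(X : ℝ)⌋₊ (y + 1))) : Set (ℕ × ℕ)) ⊆
      {p : ℕ × ℕ | 0 < p.1 ∧ 0 < p.2 ∧ p.1 + p.2 ≤ X ∧ ∀ q : ℕ, q.Prime →
        q ∣ p.1 * p.2 * (p.1 + p.2) → (q : ℝ) ≤ Real.log X ^ K'} := by
  intro p hp
  rw [Finset.coe_filter] at hp
  obtain ⟨hpI, h1, h2, h3⟩ := hp
  rw [Finset.mem_product, Finset.mem_Icc, Finset.mem_Icc] at hpI
  have hsum : p.1 + p.2 ≤ X := by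
    have := (Nat.mem_smoothNumbersUpTo.mp h3).1
    rwa [Nat.floor_natCast] at this
  refine ⟨hpI.1.1, hpI.2.1, hsum, fun q hq hdvd => ?_⟩
  have hS1 := (Nat.mem_smoothNumbersUpTo.mp h1).2
  have hS2 := (Nat.mem_smoothNumbersUpTo.mp h2).2
  have hS3 := (Nat.mem_smoothNumbersUpTo.mp h3).2
  have hqy : q < y + 1 := by
    rcases (Nat.Prime.dvd_mul hq).mp hdvd with h12 | h3'
    · rcases (Nat.Prime.dvd_mul hq).mp h12 with h1' | h2'
      · exact Nat.mem_smoothNumbers'.mp hS1 q hq h1'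
      · exact Nat.mem_smoothNumbers'.mp hS2 q hq h2'
    · exact Nat.mem_smoothNumbers'.mp hS3 q hq h3'
  have : (q : ℝ) ≤ y := by exact_mod_cast Nat.lt_add_one_iff.mp hqy
  exact this.trans hy

/-- `2^{19} ≤ e^{14}`. [folklore] -/
theorem two_pow_19_le_exp_14 : (2 : ℝ) ^ 19 ≤ Real.exp 14 := by
  have h := Real.exp_one_gt_d9
  calc (2 : ℝ) ^ 19 ≤ (2718 / 1000 : ℝ) ^ 14 := by norm_num
    _ ≤ Real.exp 1 ^ 14 := pow_le_pow_left₀ (by norm_num) (by linarith) 14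
    _ = Real.exp 14 := by rw [← Real.exp_nat_mul]; norm_num

set_option maxHeartbeats 3200000 in
/-- **Smooth solutions of `a + b = c` are abundant** ([Harper2016, Cor. 1] in the form needed for the
xyz conjecture): there is `K` such that for arbitrarily large natural `X` at least `X^{3/2}` pairs
`(a, b)` with `a + b ≤ X` have `ab(a+b)` composed only of primes `≤ (log X)^K`.
[cite: Harper2016, Cor. 1, §5] [cite: LagariasSoundararajan2011, Thm. 1.5] -/
theorem smooth_abc_pairs_frequently :
    ∃ K : ℕ, ∃ᶠ X : ℕ in atTop, ((X : ℝ)) ^ (1 + (1 / 2 : ℝ)) ≤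
      ({p : ℕ × ℕ | 0 < p.1 ∧ 0 < p.2 ∧ p.1 + p.2 ≤ X ∧ ∀ q : ℕ, q.Prime →
        q ∣ p.1 * p.2 * (p.1 + p.2) → (q : ℝ) ≤ Real.log X ^ K}.ncard : ℝ) := by
  obtain ⟨c_g, hc_g, c₄, hc₄, C_g, hG⟩ := exists_goodLevel
  -- ### the parameters `θ₀`, `δ₁`, `K`
  set m : ℝ := max (Real.log (20 * C_g)) 1 with hm
  have hm1 : 1 ≤ m := le_max_right _ _
  have hm0 : 0 < m := by linarith
  set θ₀ : ℝ := min (min c₄ (1 / 5)) (c_g / m) with hθ₀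
  have hθ₀0 : 0 < θ₀ := lt_min (lt_min hc₄ (by norm_num)) (div_pos hc_g hm0)
  have hθ₀c₄ : θ₀ ≤ c₄ := (min_le_left _ _).trans (min_le_left _ _)
  have hθ₀5 : θ₀ ≤ 1 / 5 := (min_le_left _ _).trans (min_le_right _ _)
  have hθ₀m : θ₀ ≤ c_g / m := min_le_right _ _
  set δ₀ : ℝ := C_g * Real.exp (-c_g / θ₀) with hδ₀
  have hδ₀le : δ₀ ≤ 1 / 20 := by
    rcases le_or_gt C_g 0 with hC | hC
    · have : δ₀ ≤ 0 := mul_nonpos_of_nonpos_of_nonneg hC (Real.exp_pos _).le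
      linarith
    · have h1 : m ≤ c_g / θ₀ := by
        rw [le_div_iff₀ hθ₀0]
        rw [le_div_iff₀ hm0] at hθ₀m
        linarith
      have h2 : Real.log (20 * C_g) ≤ c_g / θ₀ := (le_max_left _ _).trans h1
      have h3 : Real.exp (-c_g / θ₀) ≤ Real.exp (-Real.log (20 * C_g)) := Real.exp_le_exp.mpr (by rw [neg_div]; linarith)
      rw [Real.exp_neg, Real.exp_log (by positivity)] at h3
      calc δ₀ = C_g * Real.exp (-c_g / θ₀) := rfl
        _ ≤ C_g * (20 * C_g)⁻¹ := mul_le_mul_of_nonneg_left h3 hC.le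
        _ = 1 / 20 := by field_simp
  set δ₁ : ℝ := max δ₀ 0 with hδ₁
  have hδ₁0 : 0 ≤ δ₁ := le_max_right _ _
  have hδ₁le : δ₁ ≤ 1 / 20 := max_le hδ₀le (by norm_num)
  set K : ℕ := ⌈820 / θ₀⌉₊ + 4000000 with hKdef
  have hK4000 : 4000 ≤ K := by omega
  have hKθ : 820 ≤ (K : ℝ) * θ₀ := by
    have h1 : 820 / θ₀ ≤ (⌈820 / θ₀⌉₊ : ℝ) := Nat.le_ceil _
    have h2 : (⌈820 / θ₀⌉₊ : ℝ) ≤ K := by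
      have : ⌈820 / θ₀⌉₊ ≤ K := Nat.le_add_right _ _
      exact_mod_cast this
    have e : 820 / θ₀ * θ₀ = 820 := div_mul_cancel₀ _ hθ₀0.ne'
    calc (820 : ℝ) = 820 / θ₀ * θ₀ := e.symm
      _ ≤ (⌈820 / θ₀⌉₊ : ℝ) * θ₀ := mul_le_mul_of_nonneg_right h1 hθ₀0.le
      _ ≤ (K : ℝ) * θ₀ := mul_le_mul_of_nonneg_right h2 hθ₀0.le
  -- ### the constants
  obtain ⟨C, C', x₀, hC, hC', hMain⟩ := count_lower_bound hδ₁0 hδ₁le hθ₀0 hθ₀5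
  obtain ⟨c_s, x_s, hc_s, hlow⟩ := le_rpow_one_sub_saddlePoint
  obtain ⟨C_s, x_S, hC_s, hup⟩ := rpow_one_sub_saddlePoint_le
  obtain ⟨x_φ, hφhi⟩ := saddlePhi₂_saddlePoint_le
  obtain ⟨x₁, hlt1⟩ := saddlePoint_lt_one
  obtain ⟨L_r, hreg⟩ := regime_facts hK4000 hθ₀0 hθ₀5 hKθ
  obtain ⟨L_ν, hν⟩ := decayNu_le (K := K) hθ₀0 hθ₀5 hKθ hc_s
  obtain ⟨L_J, hJunk⟩ := junk_small K θ₀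
  obtain ⟨L_M, hMge⟩ := main_quantity_ge K
  obtain ⟨L_m, hMinor⟩ := minor_small K hC hC' hC_s
  have hB2 := le_saddlePoint_of_polylog (K := 4000000) (ε := 1 / 4000000) (by norm_num) (by norm_num)
  have hP2 := card_smoothNumbersUpTo_polylog_ge (κ := 80000) (ε := 1 / 80000) (by norm_num) (by norm_num)
  refine ⟨K + 2, ?_⟩
  rw [Filter.frequently_atTop]
  intro X₀
  obtain ⟨X₁, hX₁⟩ := Filter.eventually_atTop.mp (hB2.and hP2)
  -- ### thresholds: `Tx` for `x`, `Lstar` for `L = log x`, `Ystar` for `y`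
  set Tx : ℝ := max (max (max x₀ x_s) (max x_S x_φ)) (max (max x₁ 1) (max (X₀ : ℝ) (X₁ : ℝ))) with hTx
  have hTx1 : 1 ≤ Tx := le_trans (le_max_right _ _) ((le_max_left _ _).trans (le_max_right _ _))
  have hTx0 : 0 < Tx := by linarith
  set Lstar : ℝ := max (max (Real.log Tx) (max L_r L_ν)) (max (max L_J L_M) (max L_m (2 * ((K : ℝ) + 1) + 30))) with hLstar
  have hLstarK : 2 * ((K : ℝ) + 1) + 30 ≤ Lstar := le_trans (le_max_right _ _) ((le_max_right _ _).trans (le_max_right _ _))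
  have hLstar0 : 0 ≤ Lstar := by have : (0 : ℝ) ≤ K := Nat.cast_nonneg K; linarith
  set Ystar : ℕ := ⌈Lstar ^ (K + 1)⌉₊ with hYstar
  obtain ⟨y, hyY, hy2, hgood⟩ := hG θ₀ hθ₀0 hθ₀c₄ Ystar
  set t : ℝ := (y : ℝ) ^ (1 / ((K : ℝ) + 1)) with ht
  have hy0 : (0 : ℝ) < y := by exact_mod_cast (show 0 < y by omega)
  have ht0 : 0 ≤ t := Real.rpow_nonneg hy0.le _
  have htpow : t ^ (K + 1) = y := by
    rw [ht, ← Real.rpow_natCast, ← Real.rpow_mul hy0.le]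
    have : (1 / ((K : ℝ) + 1)) * ((K + 1 : ℕ) : ℝ) = 1 := by push_cast; field_simp
    rw [this, Real.rpow_one]
  set X : ℕ := ⌈Real.exp t⌉₊ with hXdef
  have hXexp : Real.exp t ≤ X := Nat.le_ceil _
  have hX0 : (0 : ℝ) < X := lt_of_lt_of_le (Real.exp_pos t) hXexp
  have hX1 : (1 : ℝ) ≤ X := le_trans (by have := Real.add_one_le_exp t; linarith) hXexp
  set L : ℝ := Real.log X with hL
  have htL : t ≤ L := by rw [hL, Real.le_log_iff_exp_le hX0]; exact hXexp
  -- `Lstar ≤ t ≤ L`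
  have hLstar_t : Lstar ≤ t := by
    have h1 : Lstar ^ (K + 1) ≤ y := le_trans (Nat.le_ceil _) (by exact_mod_cast hyY)
    have h2 : (Lstar ^ (K + 1)) ^ (1 / ((K : ℝ) + 1)) ≤ t := Real.rpow_le_rpow (by positivity) h1 (by positivity)
    rw [← Real.rpow_natCast, ← Real.rpow_mul hLstar0] at h2
    have : ((K + 1 : ℕ) : ℝ) * (1 / ((K : ℝ) + 1)) = 1 := by push_cast; field_simp
    rwa [this, Real.rpow_one] at h2
  have hLstarL : Lstar ≤ L := hLstar_t.trans htL
  have hLr : L_r ≤ L := le_trans ((le_max_left _ _).trans ((le_max_right _ _).trans (le_max_left _ _))) hLstarL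
  have hLν : L_ν ≤ L := le_trans ((le_max_right _ _).trans ((le_max_right _ _).trans (le_max_left _ _))) hLstarL
  have hLJ : L_J ≤ L := le_trans ((le_max_left _ _).trans ((le_max_left _ _).trans (le_max_right _ _))) hLstarL
  have hLM : L_M ≤ L := le_trans ((le_max_right _ _).trans ((le_max_left _ _).trans (le_max_right _ _))) hLstarL
  have hLm : L_m ≤ L := le_trans ((le_max_left _ _).trans ((le_max_right _ _).trans (le_max_right _ _))) hLstarL
  have hLK2 : 2 * ((K : ℝ) + 1) + 30 ≤ L := hLstarK.trans hLstarL
  have hLTx : Real.log Tx ≤ L := le_trans ((le_max_left _ _).trans (le_max_left _ _)) hLstarL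
  have hL30 : 30 ≤ L := by have : (0 : ℝ) ≤ K := Nat.cast_nonneg K; linarith
  have hL1 : 1 ≤ L := by linarith
  have hL0 : 0 < L := by linarith
  -- `Tx ≤ X`, hence all the `x`-thresholds
  have hTxX : Tx ≤ X := by
    have := Real.exp_le_exp.mpr hLTx
    rwa [Real.exp_log hTx0, hL, Real.exp_log hX0] at this
  have hx₀ : x₀ ≤ X := le_trans ((le_max_left _ _).trans ((le_max_left _ _).trans (le_max_left _ _))) hTxX
  have hx_s : x_s ≤ X := le_trans ((le_max_right _ _).trans ((le_max_left _ _).trans (le_max_left _ _))) hTxX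
  have hx_S : x_S ≤ X := le_trans ((le_max_left _ _).trans ((le_max_right _ _).trans (le_max_left _ _))) hTxX
  have hx_φ : x_φ ≤ X := le_trans ((le_max_right _ _).trans ((le_max_right _ _).trans (le_max_left _ _))) hTxX
  have hx₁ : x₁ ≤ X := le_trans ((le_max_left _ _).trans ((le_max_left _ _).trans (le_max_right _ _))) hTxX
  have hXX₀ : X₀ ≤ X := by
    have : (X₀ : ℝ) ≤ X := le_trans ((le_max_left _ _).trans ((le_max_right _ _).trans (le_max_right _ _))) hTxX
    exact_mod_cast this
  have hXX₁ : X₁ ≤ X := by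
    have : (X₁ : ℝ) ≤ X := le_trans ((le_max_right _ _).trans ((le_max_right _ _).trans (le_max_right _ _))) hTxX
    exact_mod_cast this
  refine ⟨X, hXX₀, ?_⟩
  -- ### `L^K ≤ y ≤ L^{K+1}`
  have hyL : (y : ℝ) ≤ L ^ (K + 1) := by rw [← htpow]; exact pow_le_pow_left₀ ht0 htL _
  have hLt1 : L ≤ t + 1 := by
    -- `X ≤ exp t + 1 ≤ 2 exp t`
    have hXle : (X : ℝ) ≤ 2 * Real.exp t := by
      have h1 : (X : ℝ) < Real.exp t + 1 := Nat.ceil_lt_add_one (Real.exp_pos t).le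
      have h2 : 1 ≤ Real.exp t := by have := Real.add_one_le_exp t; linarith
      linarith
    have := Real.log_le_log hX0 hXle
    rw [Real.log_mul (by norm_num) (Real.exp_pos t).ne', Real.log_exp] at this
    have := Real.log_two_lt_d9; linarith
  have hLK : L ^ K ≤ y := by
    have h1 : (L - 1) ^ (K + 1) ≤ y := by
      rw [← htpow]; exact pow_le_pow_left₀ (by linarith) (by linarith) _
    refine le_trans ?_ h1
    -- Bernoulli: `(L-1)^{K+1} = L^{K+1} (1 - 1/L)^{K+1} ≥ L^{K+1} (1 - (K+1)/L) ≥ L^{K+1}/2 ≥ L^K`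
    have hB := one_add_mul_le_pow (show (-2 : ℝ) ≤ -1 / L by rw [neg_div]; exact neg_le_neg (by rw [div_le_iff₀ hL0]; linarith)) (K + 1)
    have hhalf : (1 : ℝ) / 2 ≤ 1 + ((K + 1 : ℕ) : ℝ) * (-1 / L) := by
      push_cast
      rw [show 1 + ((K : ℝ) + 1) * (-1 / L) = 1 - ((K : ℝ) + 1) / L by ring]
      have : ((K : ℝ) + 1) / L ≤ 1 / 2 := by rw [div_le_iff₀ hL0]; linarith
      linarith
    have e : (L - 1) ^ (K + 1) = L ^ (K + 1) * (1 + -1 / L) ^ (K + 1) := by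
      rw [← mul_pow]; congr 1; field_simp; ring
    rw [e]
    calc L ^ K = L ^ (K + 1) * (1 / 2) * (2 / L) := by field_simp; ring
      _ ≤ L ^ (K + 1) * (1 / 2) * 1 := by
          apply mul_le_mul_of_nonneg_left _ (by positivity)
          rw [div_le_one hL0]; linarith
      _ = L ^ (K + 1) * (1 / 2) := mul_one _
      _ ≤ L ^ (K + 1) * (1 + -1 / L) ^ (K + 1) := mul_le_mul_of_nonneg_left (hhalf.trans hB) (by positivity)
  -- ### the regime
  obtain ⟨h8, h200, hlogy6, h25, hlogy1, hlogyK, hy2', h240, hΛ8, hΛx, hyx, hΛθ, hs1, hs2, hs3⟩ :=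
    hreg X y hLr hX0 hLK hyL
  have h3 : Real.log X ^ 3 ≤ y := le_trans (pow_le_pow_right₀ hL1 (by norm_num)) h8
  have hX1' : (1 : ℝ) < X := by
    by_contra h0; push Not at h0
    have : L ≤ 0 := Real.log_nonpos hX0.le h0
    linarith
  set α : ℝ := saddlePoint X y with hα
  have hα0 : 0 < α := saddlePoint_pos hX1' hy2'
  have hlogy6' : Real.log y ≤ Real.log X ^ (1 / 6 : ℝ) := by
    have : 0 ≤ Real.log X ^ (1 / 6 : ℝ) := Real.rpow_nonneg hL0.le _
    linarith
  have hα1 : α ≤ 1 := (hlt1 X y hx₁ h3 hyx hlogy6').le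
  -- `α ≥ 1 - 5·10⁻⁷`
  have hαlo : 1 - 1 / 2000000 ≤ α := by
    have h := (hX₁ X hXX₁).1 y ?_
    · have e : (1 : ℝ) - 1 / 4000000 - 1 / 4000000 = 1 - 1 / 2000000 := by norm_num
      rw [e] at h; exact h
    · have : Real.log X ^ (4000000 : ℝ) ≤ y := by
        rw [show (4000000 : ℝ) = ((4000000 : ℕ) : ℝ) by norm_num, Real.rpow_natCast]
        exact le_trans (pow_le_pow_right₀ hL1 (by omega)) hLK
      linarith [Real.rpow_nonneg hL0.le (4000000 : ℝ)]
  -- `Ψ ≥ X^{39999/40000}`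
  have hΨ : (X : ℝ) ^ ((39999 : ℝ) / 40000) ≤ ((Nat.smoothNumbersUpTo ⌊(X : ℝ)⌋₊ (y + 1)).card : ℝ) := by
    have h := (hX₁ X hXX₁).2
    have e : (1 : ℝ) - 1 / 80000 - 1 / 80000 = 39999 / 40000 := by norm_num
    rw [e] at h
    refine h.trans ?_
    rw [Nat.floor_natCast]
    have hk : ⌊Real.log X ^ (80000 : ℝ)⌋₊ + 1 ≤ y + 1 := by
      have : Real.log X ^ (80000 : ℝ) ≤ y := by
        rw [show (80000 : ℝ) = ((80000 : ℕ) : ℝ) by norm_num, Real.rpow_natCast]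
        exact le_trans (pow_le_pow_right₀ hL1 (by omega)) hLK
      exact Nat.add_le_add_right (Nat.floor_le_of_le this) 1
    exact_mod_cast Finset.card_le_card (smoothNumbersUpTo_mono_right X hk)
  -- the saddle-point size facts
  have hlow' := hlow X y hx_s h3 hyx
  have hup' := hup X y hx_S h3 hyx
  have hφ' := hφhi X y hx_φ h3 hyx
  rw [← hα] at hlow' hup' hφ'
  have hν' := hν X y α hLν hLK hyL hα0.le hα1 hlow'
  have hJ' := hJunk X y α hLJ hX0 hy2' hlogyK hα0 hα1 hφ' hν'
  have hfloorX : ((⌊(X : ℝ)⌋₊ : ℕ) : ℝ) ≤ X := Nat.floor_le hX0.le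
  have hM' := hMge X ⌊(X : ℝ)⌋₊ y α hLM hX0 hfloorX hy2' hlogyK hα0 hφ' hΨ
  have hΨle : ((Nat.smoothNumbersUpTo ⌊(X : ℝ)⌋₊ (y + 1)).card : ℝ) ≤ (X : ℝ) ^ α * smoothZeta α y := by
    have hR := card_smoothNumbersUpTo_le_rankin ⌊(X : ℝ)⌋₊ (y + 1) hα0
    rw [← smoothZeta_eq_prod_primesBelow] at hR
    refine hR.trans (mul_le_mul_of_nonneg_right ?_ (smoothZeta_pos hα0).le)
    exact Real.rpow_le_rpow (Nat.cast_nonneg _) hfloorX hα0.le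
  have hm' := hMinor X y α _ hLm hX0 hy2' hlogy1 hlogyK hyL hα0 hα1 hαlo hφ' hup' (Nat.cast_nonneg _) hΨle hM'
  have hgood' : GoodLevel δ₁ θ₀ y := GoodLevel.mono hgood (le_max_left _ _) (by omega)
  -- ### the weighted count
  have hcount := hMain X y hx₀ h8 h200 hlogy6 hgood' h25 hs1 hs2 hs3 hαlo hΨ (Real.log X ^ 100) h240 hΛ8 hΛθ le_rfl hΛx
    hJ' hm'
  rw [← hα] at hcount
  -- ### from the count to the pairs
  have hpairs := countW_le_card hX0 y
  have hsub := pairs_subset X y (K + 2) (hyL.trans (pow_le_pow_right₀ hL1 (by omega)))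
  have hfin : {p : ℕ × ℕ | 0 < p.1 ∧ 0 < p.2 ∧ p.1 + p.2 ≤ X ∧ ∀ q : ℕ, q.Prime →
      q ∣ p.1 * p.2 * (p.1 + p.2) → (q : ℝ) ≤ Real.log X ^ (K + 2)}.Finite := by
    refine Set.Finite.subset (Finset.finite_toSet ((Finset.range (X + 1)) ×ˢ (Finset.range (X + 1)))) ?_
    intro p hp
    obtain ⟨-, -, hs, -⟩ := hp
    simp only [Finset.coe_product, Finset.coe_range, Set.mem_prod, Set.mem_Iio]
    omega
  have hncard := Set.ncard_le_ncard hsub hfin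
  rw [Set.ncard_coe_finset] at hncard
  -- ### the numerical lower bound `X^{3/2} ≤ 4096 · T/(2^29 X)`
  set Mx : ℝ := (X : ℝ) ^ α * smoothZeta α y / Real.sqrt (2 * Real.pi * saddlePhi₂ α y) with hMx
  have hMx0 : 0 < Mx := lt_of_lt_of_le (Real.rpow_pos_of_pos hX0 _) hM'
  have h2α : 1 / 2 ≤ (2 : ℝ) ^ (-α) := by
    rw [Real.rpow_neg (by norm_num), one_div]
    apply inv_anti₀ (by positivity)
    calc (2 : ℝ) ^ α ≤ 2 ^ (1 : ℝ) := Real.rpow_le_rpow_of_exponent_le (by norm_num) hα1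
      _ = 2 := Real.rpow_one 2
  have hT : Mx ^ 3 / 4 ≤ ((2 : ℝ) ^ (-α) * Mx) ^ 2 * Mx := by
    have h4 : (1 / 2 : ℝ) ^ 2 ≤ ((2 : ℝ) ^ (-α)) ^ 2 := pow_le_pow_left₀ (by norm_num) h2α 2
    have : Mx ^ 3 / 4 = (1 / 2 : ℝ) ^ 2 * Mx ^ 3 := by ring
    rw [this, show ((2 : ℝ) ^ (-α) * Mx) ^ 2 * Mx = ((2 : ℝ) ^ (-α)) ^ 2 * Mx ^ 3 by ring]
    exact mul_le_mul_of_nonneg_right h4 (by positivity)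
  have hMx3 : (X : ℝ) ^ ((297 : ℝ) / 100) ≤ Mx ^ 3 := by
    have : ((X : ℝ) ^ ((99 : ℝ) / 100)) ^ 3 = (X : ℝ) ^ ((297 : ℝ) / 100) := by
      rw [← Real.rpow_natCast, ← Real.rpow_mul hX0.le]; norm_num
    rw [← this]; exact pow_le_pow_left₀ (by positivity) hM' 3
  have hX47 : (2 : ℝ) ^ 19 ≤ (X : ℝ) ^ ((47 : ℝ) / 100) := by
    refine two_pow_19_le_exp_14.trans ?_
    rw [Real.rpow_def_of_pos hX0, ← hL]
    exact Real.exp_le_exp.mpr (by linarith)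
  have hsplit : (X : ℝ) ^ ((297 : ℝ) / 100) = (X : ℝ) ^ (1 + (1 / 2 : ℝ)) * (X : ℝ) ^ ((47 : ℝ) / 100) * X := by
    rw [← Real.rpow_add hX0, ← Real.rpow_add_one hX0.ne']; norm_num
  have hfinal : (X : ℝ) ^ (1 + (1 / 2 : ℝ)) ≤ 4096 * (((2 : ℝ) ^ (-α) * Mx) ^ 2 * Mx / (2 ^ 29 * X)) := by
    rw [mul_div_assoc', le_div_iff₀ (by positivity)]
    have hX32 : 0 ≤ (X : ℝ) ^ (1 + (1 / 2 : ℝ)) := Real.rpow_nonneg hX0.le _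
    calc (X : ℝ) ^ (1 + (1 / 2 : ℝ)) * (2 ^ 29 * X) = ((X : ℝ) ^ (1 + (1 / 2 : ℝ)) * 2 ^ 19 * X) * 2 ^ 10 := by ring
      _ ≤ ((X : ℝ) ^ (1 + (1 / 2 : ℝ)) * (X : ℝ) ^ ((47 : ℝ) / 100) * X) * 2 ^ 10 := by
          apply mul_le_mul_of_nonneg_right _ (by norm_num)
          exact mul_le_mul_of_nonneg_right (mul_le_mul_of_nonneg_left hX47 hX32) hX0.le
      _ = (X : ℝ) ^ ((297 : ℝ) / 100) * 2 ^ 10 := by rw [hsplit]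
      _ ≤ Mx ^ 3 * 2 ^ 10 := mul_le_mul_of_nonneg_right hMx3 (by norm_num)
      _ = 4096 * (Mx ^ 3 / 4) := by ring
      _ ≤ 4096 * (((2 : ℝ) ^ (-α) * Mx) ^ 2 * Mx) := mul_le_mul_of_nonneg_left hT (by norm_num)
  calc (X : ℝ) ^ (1 + (1 / 2 : ℝ)) ≤ 4096 * (((2 : ℝ) ^ (-α) * Mx) ^ 2 * Mx / (2 ^ 29 * X)) := hfinal
    _ ≤ 4096 * _ := mul_le_mul_of_nonneg_left hcount (by norm_num)
    _ ≤ _ := hpairs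
    _ ≤ _ := by exact_mod_cast hncard

end Endgame

end Literature.NumberTheory.Sieve

end
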